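import Mathlib
import HarnessLib
import Literature.Combinatorics.Additive.NearlyPeriodicSummands
import Literature.Combinatorics.Additive.EnergyIntersectionInequalities
import Literature.Combinatorics.Additive.HamidouneRodsethAbelianPairs

/-!
# The vocabulary of the Kemperman Structure Theorem in Grynkiewicz's quasi-periodic language:
# elementary pairs of types (I)–(IV), unique expression elements, `|φ_H(X)|`, Kemperman
# decompositions (conditions (i)–(iv)), and the «if» half of KST

[cite: Grynkiewicz2009, §2] [tag: critical-pair] [tag: inverse-theorem]

Topic `Literature/Combinatorics/Additive`.  Cell `mm-stpp` (D-0046), seat `mm-stpp-lit` (gen 22);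
continuation of `QuasiPeriodicDecompositions.lean` (S111: `IsPeriodicWith`, `IsQuasiPeriodicDecomp`,
`IsQuasiPeriodic`, `addConvolution_eq_card_filter`), `QuasiProgressions.lean` (S116: `IsPeriodic`,
`isPeriodicWith_zmultiples_of_vadd_eq`, `not_isPeriodic_of_isPeriodicWith_insert`, the `(Hf, hHf)`
convention for subgroups carried as finsets) and `NearlyPeriodicSummands.lean` (S124:
`Grynkiewicz2009.vadd_subset_add_of_card_lt`, Proposition 2.1 (i) inside a coset); arithmetic
progressions are the tree's `apFinset` / `IsAP` (`Vosper.lean`; `Isoperimetric.apFinset_add_apFinset`,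
`Isoperimetric.card_apFinset_of_le_addOrderOf` of the Hamidoune–Rødseth files), the representation count
`r_{A,B}(x)` is Mathlib's `Finset.addConvolution A B x`, and `Σ_x r_{A,B}(x) = |A||B|` is
`sum_addConvolution` (`EnergyIntersectionInequalities.lean`).

SOURCE.  D. J. Grynkiewicz, *A step beyond Kemperman's structure theorem*, Mathematika **55** (2009)
67–114, §2, print p. 70 (the four types of elementary pairs, the remarks after them, and the
statement of the Kemperman Structure Theorem (KST) with conditions (i)–(iv)), read from the held
publisher text `paper:doi-10-1112-s0025579300000966` (p0004; p0003 for `r_{A,B}`, `φ_H`, punctured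
periodic sets).  This file types the VOCABULARY in which KST and Theorem 4.1 (KST+1) of the paper are
stated, and proves what print calls immediate:

* `addConvolution_eq_one_iff`, `addConvolution_add_eq_one_iff` — «`x` is a unique expression element
  in `A + B` when `r_{A,B}(x) = 1`», unfolded.
* `cosetCount H X = |φ_H(X)|` (a reviewed DEFINITION: the number of `H`-cosets met by `X`, the
  cardinality of the image of `X` in `G ⧸ H`), with `cosetCount_eq_card_image`, `cosetCount_empty`,
  `cosetCount_pos`, `cosetCount_eq_one_of_sub_mem`, `cosetCount_union` (additive over sets meeting
  different cosets), `card_eq_cosetCount_mul` (`|X| = |φ_H(X)|·|H|` for `H`-periodic `X`), and for a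
  quasi-periodic decomposition `IsQuasiPeriodicDecomp.sub_notMem` / `mem_right_of_sub_mem` /
  `cosetCount_eq` (`|φ_H(A)| = |φ_H(A₁)| + 1`).
* Subgroups as finsets: `exists_finset_carrier`,
  `finite_coe_of_isPeriodicWith` (a subgroup with a nonempty finite periodic set is finite),
  `isPeriodicWith_vadd_carrier`, `subset_vadd_carrier_of_sub_mem`; progressions:
  `card_apFinset_of_addOrderOf` (distinct terms when the order of `d` is infinite or `≥ n`; the sum of
  two progressions is `Isoperimetric.apFinset_add_apFinset` of `HamidouneRodsethAbelianPairs.lean`);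
  `add_eq_vadd_carrier_of_card_lt` (Prop 2.1 (i) in a coset, equality form);
  `two_mul_card_add_eq_of_card_eq_two` (`|A| = 2` ⇒ `2|A + B| = u + 2|B|`, `u` = number of unique
  expression elements).
* **The four types of elementary pairs** (reviewed DEFINITIONS, verbatim from p. 70):
  `IsElementaryI` (`|A| = 1` or `|B| = 1`), `IsElementaryII` (`|A|, |B| ≥ 2`, progressions with a
  common difference `d` «where the order of `d` is at least `|A| + |B| − 1`» — `addOrderOf d = 0`
  (infinite order) `∨ |A| + |B| − 1 ≤ addOrderOf d`), `IsElementaryIII` (`A ⊆ a + H`, `B ⊆ b + H`,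
  `a ∈ A`, `b ∈ B`, `|A| + |B| = |H| + 1`, and `a + b` is the ONLY unique expression element),
  `IsElementaryIV` (`A ⊆ a + H`, `B ⊆ b + H`, no unique expression element, `A` and `B` aperiodic,
  `A = g − (b + H) ∖ B`), and `IsElementaryPair` (their disjunction).  PROVED, as printed after the
  definitions: «in all four cases `|A + B| = |A| + |B| − 1`» (`IsElementaryI/II/III/IV.card_add`,
  `IsElementaryPair.card_add`); «in particular `|A + B| = |H| − 1` when `(A, B)` has type (IV)»
  (`IsElementaryIV.card_add_of_data`, `exists_card_add_succ_eq`; the structure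
  `IsElementaryIV.add_eq_of_data`: `A + B = (a + b + H) ∖ {g}`, using only that `B` is aperiodic;
  hence `IsElementaryIV.not_isPeriodic_add`); «(and thus `A + B = a + b + H` by Proposition 2.1)» for
  type (III) (`IsElementaryIII.add_eq_of_data`); «the additional conditions on unique expression
  elements for type (III) and (IV) pairs imply `|A|, |B| ≥ 3`» (`IsElementaryIV.three_le_card`;
  `IsElementaryIII.card_eq_one_or_three_le` — the printed type (III) also admits the degenerate pair
  `({a}, {b})` with `H` trivial, listed as the alternative `|A| = |B| = 1`); unique expression elements
  of types (I)–(III) (`….exists_addConvolution_eq_one`, `IsElementaryI.addConvolution_eq_one`,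
  `IsElementaryPair.exists_addConvolution_eq_one_or`); symmetry of (I), (II); `IsElementaryII.isAP_add`.
* **Kemperman decompositions** `IsKempermanDecomp H A B A₁ A₀ B₁ B₀` (a reviewed DEFINITION, a
  `structure … : Prop`): quasi-periodic decompositions of `A` and `B` with common quasi-period `H`,
  `A₀, B₀ ≠ ∅`, and KST's (i)–(iv) — (i) elementwise (equivalent to the quotient form
  `r_{φ_H(A),φ_H(B)}(φ_H(a₀) + φ_H(b₀)) = 1`: `quot_unique_iff_addConvolution_image`), (ii) through
  `cosetCount`, (iii) through `addConvolution`, (iv) `IsElementaryPair A₀ B₀`.  PROVED: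
  `IsKempermanDecomp.add_eq` / `isPeriodicWith_part` / `sub_notMem` / `disjoint_parts` /
  `isQuasiPeriodicDecomp_add` (`A + B = ((A₁ + B) ∪ (A₀ + B₁)) ∪ (A₀ + B₀)` is a quasi-periodic
  decomposition whose aperiodic part alone meets the coset `φ_H(A₀) + φ_H(B₀)`), `cosetCount_add_eq`,
  `addConvolution_eq` (`r_{A,B} = r_{A₀,B₀}` on `A₀ + B₀`), and
  **the «if» direction of KST**: `IsKempermanDecomp.card_add` (`|A + B| = |A| + |B| − 1`),
  `IsKempermanDecomp.not_isPeriodic_add` (type (IV) at the bottom ⇒ `A + B` aperiodic),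
  `IsKempermanDecomp.not_isPeriodic_or_exists`, packaged as `card_add_and_of_exists_isKempermanDecomp`
  — valid in every abelian group (print: `G` finite).
* **Invariance** (section `Invariance`; «by translating and considering `−A` and `−B` if necessary,
  we may w.l.o.g. assume …», the standing normalisation of §§5–6): `addConvolution_vadd_vadd`,
  `addConvolution_neg_neg`, `isPeriodic_neg_iff`, `isPeriodic_vadd_iff`,
  `cosetCount_vadd`, `cosetCount_neg`, and `.symm` / `.vadd` / `.neg` for `IsElementaryI`,
  `IsElementaryII`, `IsElementaryIII`, `IsElementaryIV` (symmetry of (IV): `A = g − (b + H) ∖ B` iff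
  `B = g − (a + H) ∖ A`), `IsElementaryPair` and `IsKempermanDecomp` — all PROVED.
* **Kemperman's 1960 wording** (section `KempermanForms`): `isElementaryIII_iff_existsUnique` (type
  (III) with «precisely one `c` satisfies `ν_c = 1`»), `not_isPeriodic_of_eq_sub_sdiff` and
  `isElementaryIV_iff_left` (type (IV) with only the first set required aperiodic, as printed in
  Kemperman 1960 §5), and `IsElementaryPair.isKempermanDecomp_top` / `.exists_isKempermanDecomp`
  (every elementary pair is a Kemperman pair with `H = G`: the «only if» half for elementary pairs).
* **Kemperman 1960, §4, Lemmas 4.1–4.3** (section `KempermanSection4`): `kemperman_lemma41` (the sum a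
  full coset iff both sets lie in cosets with `|A| + |B| > |H|`), `kemperman_lemma42` (the sum a coset
  with one element deleted and `|A + B| ≤ |A| + |B| − 1` ⟹ `A` aperiodic in a coset,
  `B = c₀ − ((a + H) ∖ A)`, equality) with `isElementaryIV_of_add_eq_erase`, and `kemperman_lemma43`
  (cyclic case `G = ⟨d⟩`: the sum a progression of difference `d` with `|A + B| ≤ |G| − 2` ⟹ both
  sets are progressions of difference `d`; proved through the Vosper-type transfer
  `Isoperimetric.isAP_of_isAP_of_card_add_le`, with `IsAP.compl_of_zmultiples_eq_top`) and
  `isElementaryII_of_isAP_add` (hence type (II), with equality in (1)); the remarks «`|H| ≥ 6` for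
  type (IV)» (`IsElementaryIV.six_le_card_add_card`) and «(i), (ii) make `(φ_H(A), φ_H(B))` satisfy
  the hypothesis of KST» (`IsKempermanDecomp.image_quotient`).
* **Kemperman's own form of the decompositions** `IsKempermanDecompI` (Kemperman 1960 Thm 5.1
  (i)–(iv) = Grynkiewicz 2005 «KST I»; no condition (iii) of 2009), with `IsKempermanDecomp.toDecompI`,
  `IsKempermanDecompI.symm`, `IsElementaryPair.isKempermanDecompI_top` — the target of the «only if»
  half in Kemperman's form.

WHAT THIS FILE IS NOT.  The «only if» direction of KST (every critical pair with `A + B` aperiodic or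
with a unique expression element HAS such decompositions — Kemperman 1960 [28]; in this quasi-periodic
form with (iii) Grynkiewicz 2005 [10] [11]) is NOT here: the tree's Kemperman theorem is the
Boothby–DeVos–Montejano recursive classification of critical trios (`KempermanStructureTheorem.lean`:
`kemperman_structure_chain`, `kemperman_critical_pair`; `KempermanStructures.lean`: pure/impure beats and
chords), and the bridge from that chain to `IsKempermanDecomp` is successor work.  Nor are Theorem 4.1
(KST+1), Lemmas 5.9/5.10 or Corollaries 4.2–4.4 here.  Everything in this file is PROVED (0 named
facts); census-silent for the cell `mm-stpp`.

## References
* D. J. Grynkiewicz, *A step beyond Kemperman's structure theorem*, Mathematika 55 (2009) 67–114,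
  doi:10.1112/S0025579300000966, §2 (p. 69: `r_{A,B}`, `φ_H`, punctured periodic sets; p. 70: elementary
  pairs (I)–(IV), the remarks, KST with (i)–(iv)) — held `paper:doi-10-1112-s0025579300000966`, pages
  p0003–p0004 read 2026-08-29 [cite: Grynkiewicz2009, §2].
* J. H. B. Kemperman, *On small sumsets in an abelian group*, Acta Math. 103 (1960) 63–88,
  doi:10.1007/BF02546525 (the theorem = its Theorem 5.1, §5 pp. 78–79; the elementary pairs (I)–(IV)
  defined on p. 78) — held `paper:doi-10-1007-bf02546525`, p0016–p0017 read 2026-08-29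
  [cite: Kemperman1960, §5; Thm 5.1].
* D. J. Grynkiewicz, *Quasi-periodic decompositions and the Kemperman structure theorem*, European J.
  Combin. 26 (2005) 559–575 (the source's [10]; condition (iii); cited through the source).
-/

namespace Literature.Combinatorics.Additive

open Finset
open scoped Pointwise

variable {G : Type*} [AddCommGroup G] [DecidableEq G]

/-! ### Unique expression elements (`r_{A,B}(x) = 1`) -/

/-- `x` is a unique expression element of `A + B` (`r_{A,B}(x) = 1`) iff exactly one `b ∈ B` has
`x − b ∈ A`. [cite: Grynkiewicz2009, §2] -/
theorem addConvolution_eq_one_iff {A B : Finset G} {x : G} :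
    A.addConvolution B x = 1 ↔ ∃ b ∈ B, x - b ∈ A ∧ ∀ b' ∈ B, x - b' ∈ A → b' = b := by
  rw [addConvolution_eq_card_filter, card_eq_one]
  constructor
  · rintro ⟨b, hb⟩
    have hbmem : b ∈ B.filter fun b => x - b ∈ A := by rw [hb]; exact mem_singleton_self b
    rw [mem_filter] at hbmem
    refine ⟨b, hbmem.1, hbmem.2, fun b' hb' hxb' => ?_⟩
    have : b' ∈ B.filter fun b => x - b ∈ A := mem_filter.2 ⟨hb', hxb'⟩
    rw [hb] at this
    exact mem_singleton.1 this
  · rintro ⟨b, hb, hxb, huniq⟩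
    refine ⟨b, ?_⟩
    ext b'
    rw [mem_filter, mem_singleton]
    exact ⟨fun h => huniq b' h.1 h.2, fun h => by rw [h]; exact ⟨hb, hxb⟩⟩

/-- `a + b` (`a ∈ A`, `b ∈ B`) is a unique expression element of `A + B` iff every representation
`a' + b' = a + b` with `a' ∈ A`, `b' ∈ B` has `b' = b` (and hence `a' = a`). [cite: Grynkiewicz2009, §2] -/
theorem addConvolution_add_eq_one_iff {A B : Finset G} {a b : G} (ha : a ∈ A) (hb : b ∈ B) :
    A.addConvolution B (a + b) = 1 ↔ ∀ a' ∈ A, ∀ b' ∈ B, a' + b' = a + b → b' = b := by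
  rw [addConvolution_eq_one_iff]
  constructor
  · rintro ⟨b₀, -, -, huniq⟩ a' ha' b' hb' he
    have h1 : b = b₀ := huniq b hb (by rw [add_sub_cancel_right]; exact ha)
    have h2 : b' = b₀ := huniq b' hb' (by rw [← he, add_sub_cancel_right]; exact ha')
    rw [h1, h2]
  · intro h
    exact ⟨b, hb, by rw [add_sub_cancel_right]; exact ha, fun b' hb' hxb' =>
      h (a + b - b') hxb' b' hb' (by rw [sub_add_cancel])⟩

/-! ### `|φ_H(X)|`, the number of `H`-cosets met by a set -/

/-- **`|φ_H(X)|`**, the number of `H`-cosets met by `X`: the cardinality of the image of `X` under the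
natural homomorphism `φ_H : G → G/H` (print p. 3; used in KST (ii) `|φ_H(A+B)| = |φ_H(A)| + |φ_H(B)| − 1`).
[cite: Grynkiewicz2009, §2] -/
noncomputable def cosetCount (H : AddSubgroup G) (X : Finset G) : ℕ :=
  open scoped Classical in #(X.image (QuotientAddGroup.mk : G → G ⧸ H))

omit [DecidableEq G] in
/-- `cosetCount` is the cardinality of the image in `G ⧸ H`, for any decidability instance.
[cite: Grynkiewicz2009, §2] -/
theorem cosetCount_eq_card_image (H : AddSubgroup G) [DecidableEq (G ⧸ H)] (X : Finset G) :
    cosetCount H X = #(X.image (QuotientAddGroup.mk : G → G ⧸ H)) := by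
  unfold cosetCount
  congr 1
  ext q
  simp only [mem_image]

omit [DecidableEq G] in
/-- `|φ_H(∅)| = 0`. [cite: Grynkiewicz2009, §2] -/
theorem cosetCount_empty (H : AddSubgroup G) : cosetCount H (∅ : Finset G) = 0 := by
  classical
  rw [cosetCount_eq_card_image, image_empty, card_empty]

omit [DecidableEq G] in
/-- A nonempty set inside one `H`-coset meets exactly one coset. [cite: Grynkiewicz2009, §2] -/
theorem cosetCount_eq_one_of_sub_mem {H : AddSubgroup G} {X : Finset G} (hne : X.Nonempty)
    (h : ∀ x ∈ X, ∀ y ∈ X, x - y ∈ H) : cosetCount H X = 1 := by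
  classical
  obtain ⟨x₀, hx₀⟩ := hne
  rw [cosetCount_eq_card_image, card_eq_one]
  refine ⟨(x₀ : G ⧸ H), ?_⟩
  ext q
  rw [mem_image, mem_singleton]
  constructor
  · rintro ⟨x, hx, rfl⟩
    exact QuotientAddGroup.eq_iff_sub_mem.2 (h x hx x₀ hx₀)
  · rintro rfl
    exact ⟨x₀, hx₀, rfl⟩

omit [DecidableEq G] in
/-- `|φ_H(X)| ≥ 1` for nonempty `X`. [cite: Grynkiewicz2009, §2] -/
theorem cosetCount_pos {H : AddSubgroup G} {X : Finset G} (hne : X.Nonempty) : 0 < cosetCount H X := by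
  classical
  rw [cosetCount_eq_card_image, card_pos]
  exact hne.image _

/-- If no element of `X` is congruent modulo `H` to an element of `Y`, the cosets met by `X ∪ Y` are
those met by `X` plus those met by `Y`. [cite: Grynkiewicz2009, §2] -/
theorem cosetCount_union {H : AddSubgroup G} {X Y : Finset G} (h : ∀ x ∈ X, ∀ y ∈ Y, x - y ∉ H) :
    cosetCount H (X ∪ Y) = cosetCount H X + cosetCount H Y := by
  classical
  rw [cosetCount_eq_card_image, cosetCount_eq_card_image, cosetCount_eq_card_image, image_union,
    card_union_of_disjoint]
  rw [disjoint_left]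
  rintro q hqX hqY
  obtain ⟨x, hx, rfl⟩ := mem_image.1 hqX
  obtain ⟨y, hy, hyx⟩ := mem_image.1 hqY
  exact h x hx y hy (QuotientAddGroup.eq_iff_sub_mem.1 hyx.symm)

/-- An `H`-periodic set is the union of the `|φ_H(X)|` full cosets it meets: `|X| = |φ_H(X)| · |H|`
(`H` carried as a finset `Hf`). [cite: Grynkiewicz2009, §2] -/
theorem card_eq_cosetCount_mul {H : AddSubgroup G} {Hf : Finset G} (hHf : ∀ g, g ∈ Hf ↔ g ∈ H)
    {X : Finset G} (hX : IsPeriodicWith H X) : #X = cosetCount H X * #Hf := by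
  classical
  rw [cosetCount_eq_card_image]
  rw [card_eq_sum_card_fiberwise (f := (QuotientAddGroup.mk : G → G ⧸ H)) (t := X.image QuotientAddGroup.mk)
    fun x hx => mem_image_of_mem _ hx]
  rw [← smul_eq_mul, ← sum_const]
  refine sum_congr rfl fun q hq => ?_
  obtain ⟨x₀, hx₀, rfl⟩ := mem_image.1 hq
  have : X.filter (fun x : G => (QuotientAddGroup.mk x : G ⧸ H) = QuotientAddGroup.mk x₀) =
      x₀ +ᵥ Hf := by
    ext y
    rw [mem_filter, mem_vadd_finset]
    constructor
    · rintro ⟨hy, hyx⟩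
      refine ⟨y - x₀, (hHf _).2 (QuotientAddGroup.eq_iff_sub_mem.1 hyx), ?_⟩
      rw [vadd_eq_add, add_sub_cancel]
    · rintro ⟨h, hh, rfl⟩
      refine ⟨?_, ?_⟩
      · rw [vadd_eq_add, add_comm]; exact hX.add_mem ((hHf h).1 hh) hx₀
      · rw [QuotientAddGroup.eq_iff_sub_mem, vadd_eq_add, add_sub_cancel_left]; exact (hHf h).1 hh
  rw [this, card_vadd_finset]

/-! ### Subgroups carried as finsets -/

omit [DecidableEq G] in
/-- A subgroup with finitely many elements, carried as a finset `Hf` with `|Hf| = |H|` (the tree's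
`(Hf, hHf)` convention). [cite: Grynkiewicz2009, §2] -/
theorem exists_finset_carrier {H : AddSubgroup G} (hH : (H : Set G).Finite) :
    ∃ Hf : Finset G, (∀ g, g ∈ Hf ↔ g ∈ H) ∧ #Hf = Nat.card H := by
  refine ⟨hH.toFinset, fun g => by rw [Set.Finite.mem_toFinset, SetLike.mem_coe], ?_⟩
  rw [← Set.ncard_eq_toFinset_card (H : Set G) hH]
  exact (Nat.card_coe_set_eq (H : Set G)).symm

omit [DecidableEq G] in
/-- A subgroup of nonzero (finite) cardinality is a finite set (plumbing). [folklore] -/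
private theorem finite_coe_of_nat_card_ne_zero {H : AddSubgroup G} (h : Nat.card H ≠ 0) :
    (H : Set G).Finite := by
  have : Finite H := Nat.finite_of_card_ne_zero h
  exact Set.toFinite _

/-- A subgroup having a nonempty finite periodic set is finite (`H ↪ A`, `h ↦ h + a`).
[cite: Grynkiewicz2009, §2] -/
theorem finite_coe_of_isPeriodicWith {H : AddSubgroup G} {A : Finset G} (hA : IsPeriodicWith H A)
    (hne : A.Nonempty) : (H : Set G).Finite := by
  obtain ⟨a, ha⟩ := hne
  refine Set.Finite.subset (finite_toSet ((-a) +ᵥ A)) fun h hh => ?_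
  rw [mem_coe, mem_vadd_finset]
  exact ⟨h + a, hA.add_mem hh ha, by rw [vadd_eq_add, add_comm h a, neg_add_cancel_left]⟩

/-- A coset `c + H` (as a finset) is `H`-periodic. [cite: Grynkiewicz2009, §2] -/
theorem isPeriodicWith_vadd_carrier {H : AddSubgroup G} {Hf : Finset G} (hHf : ∀ g, g ∈ Hf ↔ g ∈ H)
    (c : G) : IsPeriodicWith H (c +ᵥ Hf) := fun h hh => by
  rw [vadd_vadd, add_comm, ← vadd_vadd, vadd_finset_eq_of_forall_mem_iff hHf hh]

/-- A set all of whose elements are congruent to `a` modulo `H` lies in the coset finset `a + Hf`.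
[cite: Grynkiewicz2009, §2] -/
theorem subset_vadd_carrier_of_sub_mem {H : AddSubgroup G} {Hf : Finset G}
    (hHf : ∀ g, g ∈ Hf ↔ g ∈ H) {A : Finset G} {a : G} (hA : ∀ x ∈ A, x - a ∈ H) : A ⊆ a +ᵥ Hf :=
  fun x hx => mem_vadd_finset.2 ⟨x - a, (hHf _).2 (hA x hx), by rw [vadd_eq_add, add_sub_cancel]⟩

/-! ### Arithmetic progressions: distinct terms -/

/-- If the order of `d` is infinite (`addOrderOf d = 0`) or at least `n`, the `n` listed terms of
`{a, a + d, …, a + (n−1)d}` are distinct. [cite: Grynkiewicz2009, §2 ("note these terms are uniquely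
defined, relative to `d`, for `l < ⟨d⟩`")] -/
theorem card_apFinset_of_addOrderOf (a d : G) {n : ℕ} (h : addOrderOf d = 0 ∨ n ≤ addOrderOf d) :
    #(apFinset a d n) = n := by
  rcases h with h0 | hn
  · have : apFinset a d n = (range n).image fun i : ℕ => a + i • d := rfl
    rw [this, card_image_of_injOn, card_range]
    intro i _ j _ hij
    exact (injective_nsmul_iff_not_isOfFinAddOrder.2 (addOrderOf_eq_zero_iff.1 h0))
      (add_left_cancel hij)
  · exact Isoperimetric.card_apFinset_of_le_addOrderOf a d hn

/-! ### Counting unique expression elements when `|A| = 2` -/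

/-- If `|A| = 2`, every `x ∈ A + B` has `r_{A,B}(x) ∈ {1, 2}`, so `2|A + B| = u + 2|B|` where `u` is
the number of unique expression elements of `A + B` (from `Σ_x r_{A,B}(x) = |A||B|`).
[cite: Grynkiewicz2009, §2 ("the additional conditions on unique expression elements for type (III)
and (IV) pairs imply |A|, |B| ≥ 3")] -/
theorem two_mul_card_add_eq_of_card_eq_two {A B : Finset G} (hA : #A = 2) :
    2 * #(A + B) = #((A + B).filter fun x => A.addConvolution B x = 1) + 2 * #B := by
  have hsum := Literature.Combinatorics.Additive.sum_addConvolution A B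
  rw [hA] at hsum
  rw [← sum_filter_add_sum_filter_not (A + B) (fun x => A.addConvolution B x = 1)] at hsum
  have h1 : ∑ x ∈ (A + B).filter (fun x => A.addConvolution B x = 1), A.addConvolution B x =
      #((A + B).filter fun x => A.addConvolution B x = 1) := by
    rw [card_eq_sum_ones]
    exact sum_congr rfl fun x hx => (mem_filter.1 hx).2
  have h2 : ∑ x ∈ (A + B).filter (fun x => ¬ A.addConvolution B x = 1), A.addConvolution B x =
      2 * #((A + B).filter fun x => ¬ A.addConvolution B x = 1) := by
    rw [mul_comm, ← smul_eq_mul, ← sum_const]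
    refine sum_congr rfl fun x hx => ?_
    obtain ⟨hxAB, hx1⟩ := mem_filter.1 hx
    have hle : A.addConvolution B x ≤ 2 := hA ▸ addConvolution_le_card_left
    have hpos : 0 < A.addConvolution B x := addConvolution_pos.2 hxAB
    omega
  have h3 := card_filter_add_card_filter_not
    (s := A + B) (fun x => A.addConvolution B x = 1)
  rw [h1, h2] at hsum
  omega

/-! ### Elementary pairs of types (I)–(IV) (print p. 70) -/

/-- **Type (I)**: «We say the pair of nonempty, finite subsets `(A, B)` of the abelian group `G` is of
type (I) if `|A| = 1` or `|B| = 1`». [cite: Grynkiewicz2009, §2 (elementary pairs, type (I))] -/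
def IsElementaryI (A B : Finset G) : Prop := A.Nonempty ∧ B.Nonempty ∧ (#A = 1 ∨ #B = 1)

/-- **Type (II)**: «if `|A| ≥ 2`, `|B| ≥ 2`, and `A` and `B` are arithmetic progressions with common
difference `d`, where the order of `d` is at least `|A| + |B| − 1`» (progressions via `IsAP` of
`Vosper.lean`; «the order of `d` is at least `|A| + |B| − 1`» in Mathlib's convention, where
`addOrderOf d = 0` encodes infinite order). [cite: Grynkiewicz2009, §2 (elementary pairs, type (II))] -/
def IsElementaryII (A B : Finset G) : Prop :=
  2 ≤ #A ∧ 2 ≤ #B ∧ ∃ d : G, IsAP A d ∧ IsAP B d ∧ (addOrderOf d = 0 ∨ #A + #B - 1 ≤ addOrderOf d)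

/-- **Type (III)**: «if `A ⊆ a + H` and `B ⊆ b + H` (for some `a ∈ A`, `b ∈ B` and `H ≤ G`),
`|A| + |B| = |H| + 1` (and thus `A + B = a + b + H` by Proposition 2.1), and `a + b` is the only unique
expression element in `A + B`» (`|H| = Nat.card H`; «unique expression element»: `r_{A,B}(x) = 1`,
i.e. Mathlib's `A.addConvolution B x = 1`, print p. 69).
[cite: Grynkiewicz2009, §2 (elementary pairs, type (III))] -/
def IsElementaryIII (A B : Finset G) : Prop :=
  ∃ (H : AddSubgroup G) (a b : G), a ∈ A ∧ b ∈ B ∧ (∀ x ∈ A, x - a ∈ H) ∧ (∀ y ∈ B, y - b ∈ H) ∧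
    #A + #B = Nat.card H + 1 ∧ ∀ x, A.addConvolution B x = 1 ↔ x = a + b

/-- **Type (IV)**: «if `A ⊆ a + H` and `B ⊆ b + H` (for some `a ∈ A`, `b ∈ B` and `H ≤ G`), `A + B`
contains no unique expression elements, `A` and `B` are aperiodic, and `A = g − (b + H) ∖ B` (for some
`g ∈ G`)» (the last clause elementwise: `x ∈ A ↔ g − x ∈ (b + H) ∖ B`; «aperiodic» = not periodic,
`IsPeriodic` of `QuasiProgressions.lean`). [cite: Grynkiewicz2009, §2 (elementary pairs, type (IV))] -/
def IsElementaryIV (A B : Finset G) : Prop :=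
  ∃ (H : AddSubgroup G) (a b g : G), a ∈ A ∧ b ∈ B ∧ (∀ x ∈ A, x - a ∈ H) ∧ (∀ y ∈ B, y - b ∈ H) ∧
    (∀ x, A.addConvolution B x ≠ 1) ∧ ¬ IsPeriodic A ∧ ¬ IsPeriodic B ∧
    ∀ x, x ∈ A ↔ (g - x) - b ∈ H ∧ g - x ∉ B

/-- «four types (I)–(IV) of elementary pairs which form the basic building blocks for all critical
pairs»: `(A, B)` is an elementary pair if it is of type (I), (II), (III) or (IV).
[cite: Grynkiewicz2009, §2 (elementary pairs)] -/
def IsElementaryPair (A B : Finset G) : Prop :=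
  IsElementaryI A B ∨ IsElementaryII A B ∨ IsElementaryIII A B ∨ IsElementaryIV A B

/-! ### Type (I) -/

namespace IsElementaryI

omit [AddCommGroup G] [DecidableEq G] in
/-- Both members of a type (I) pair are nonempty. [cite: Grynkiewicz2009, §2 (type (I))] -/
theorem nonempty {A B : Finset G} (h : IsElementaryI A B) : A.Nonempty ∧ B.Nonempty := ⟨h.1, h.2.1⟩

omit [AddCommGroup G] [DecidableEq G] in
/-- Type (I) is symmetric. [cite: Grynkiewicz2009, §2 (type (I))] -/
theorem symm {A B : Finset G} (h : IsElementaryI A B) : IsElementaryI B A :=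
  ⟨h.2.1, h.1, h.2.2.symm⟩

/-- «Note, in all four cases, that `|A + B| = |A| + |B| − 1`»: type (I).
[cite: Grynkiewicz2009, §2 (elementary pairs)] -/
theorem card_add {A B : Finset G} (h : IsElementaryI A B) : #(A + B) + 1 = #A + #B := by
  obtain ⟨-, -, h1 | h1⟩ := h
  · obtain ⟨a, rfl⟩ := card_eq_one.1 h1
    rw [singleton_add, card_vadd_finset, card_singleton, add_comm]
  · obtain ⟨b, rfl⟩ := card_eq_one.1 h1
    rw [add_comm A {b}, singleton_add, card_vadd_finset, card_singleton]

/-- In a type (I) pair every element of `A + B` is a unique expression element.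
[cite: Grynkiewicz2009, §2 (type (I))] -/
theorem addConvolution_eq_one {A B : Finset G} (h : IsElementaryI A B) {x : G} (hx : x ∈ A + B) :
    A.addConvolution B x = 1 := by
  obtain ⟨a, ha, b, hb, rfl⟩ := mem_add.1 hx
  rw [addConvolution_add_eq_one_iff ha hb]
  intro a' ha' b' hb' he
  obtain ⟨-, -, h1 | h1⟩ := h
  · have := card_eq_one.1 h1
    obtain ⟨c, hc⟩ := this
    rw [hc, mem_singleton] at ha ha'
    rw [ha', ha] at he
    exact add_left_cancel he
  · obtain ⟨c, hc⟩ := card_eq_one.1 h1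
    rw [hc, mem_singleton] at hb hb'
    rw [hb, hb']

/-- A type (I) pair has a unique expression element `a + b`, `a ∈ A`, `b ∈ B`.
[cite: Grynkiewicz2009, §2 (type (I))] -/
theorem exists_addConvolution_eq_one {A B : Finset G} (h : IsElementaryI A B) :
    ∃ a ∈ A, ∃ b ∈ B, A.addConvolution B (a + b) = 1 := by
  obtain ⟨a, ha⟩ := h.1
  obtain ⟨b, hb⟩ := h.2.1
  exact ⟨a, ha, b, hb, h.addConvolution_eq_one (add_mem_add ha hb)⟩

end IsElementaryI

/-! ### Type (II) -/

namespace IsElementaryII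

/-- Type (II) is symmetric. [cite: Grynkiewicz2009, §2 (type (II))] -/
theorem symm {A B : Finset G} (h : IsElementaryII A B) : IsElementaryII B A := by
  obtain ⟨hA, hB, d, hAd, hBd, hord⟩ := h
  refine ⟨hB, hA, d, hBd, hAd, ?_⟩
  rcases hord with h0 | hle
  · exact Or.inl h0
  · exact Or.inr (by omega)

/-- The common difference of a type (II) pair is nonzero. [cite: Grynkiewicz2009, §2 (type (II))] -/
theorem ne_zero {A : Finset G} {d : G} (hA : 2 ≤ #A) (hAd : IsAP A d) : d ≠ 0 :=
  hAd.ne_zero (by omega)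

/-- «Note, in all four cases, that `|A + B| = |A| + |B| − 1`»: type (II) — the sum is the progression
`{a + b, …, a + b + (|A| + |B| − 2)d}` whose terms are distinct because the order of `d` is at least
`|A| + |B| − 1`. [cite: Grynkiewicz2009, §2 (elementary pairs)] -/
theorem card_add {A B : Finset G} (h : IsElementaryII A B) : #(A + B) + 1 = #A + #B := by
  obtain ⟨hA2, hB2, d, ⟨a, hA⟩, ⟨b, hB⟩, hord⟩ := h
  have hsum : A + B = apFinset a d #A + apFinset b d #B := by rw [← hA, ← hB]
  rw [hsum, Isoperimetric.apFinset_add_apFinset a b d (by omega) (by omega),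
    card_apFinset_of_addOrderOf _ _ hord]
  omega

/-- The sum of a type (II) pair is a progression with the common difference.
[cite: Grynkiewicz2009, §2 (type (II))] -/
theorem isAP_add {A B : Finset G} (h : IsElementaryII A B) : ∃ d, IsAP A d ∧ IsAP B d ∧ IsAP (A + B) d := by
  obtain ⟨-, -, d, hAd, hBd, -⟩ := id h
  exact ⟨d, hAd, hBd, hAd.add hBd h.card_add⟩

/-- In a type (II) pair the sum `a + b` of the first terms is a unique expression element.
[cite: Grynkiewicz2009, §2 (type (II))] -/
theorem exists_addConvolution_eq_one {A B : Finset G} (h : IsElementaryII A B) :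
    ∃ a ∈ A, ∃ b ∈ B, A.addConvolution B (a + b) = 1 := by
  obtain ⟨hA2, hB2, d, ⟨a, hA⟩, ⟨b, hB⟩, hord⟩ := h
  have ha : a ∈ A := by rw [hA]; exact mem_apFinset.2 ⟨0, by omega, by rw [zero_nsmul, add_zero]⟩
  have hb : b ∈ B := by rw [hB]; exact mem_apFinset.2 ⟨0, by omega, by rw [zero_nsmul, add_zero]⟩
  refine ⟨a, ha, b, hb, (addConvolution_add_eq_one_iff ha hb).2 fun a' ha' b' hb' he => ?_⟩
  rw [hA] at ha'
  rw [hB] at hb'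
  obtain ⟨i, hi, rfl⟩ := mem_apFinset.1 ha'
  obtain ⟨j, hj, rfl⟩ := mem_apFinset.1 hb'
  have hij : (i + j) • d = 0 := by
    have h2 : a + b + (i + j) • d = a + b + 0 := by
      rw [add_zero]
      calc a + b + (i + j) • d = a + i • d + (b + j • d) := by rw [add_nsmul]; abel
        _ = a + b := he
    exact add_left_cancel h2
  have hij0 : i + j = 0 := by
    by_contra hne
    rcases hord with h0 | hle
    · exact addOrderOf_eq_zero_iff'.1 h0 (i + j) (by omega) hij
    · have := addOrderOf_le_of_nsmul_eq_zero (by omega) hij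
      omega
  rw [show j = 0 by omega, zero_nsmul, add_zero]

end IsElementaryII

/-! ### Proposition 2.1 (i) inside a coset, equality form -/

/-- If `X ⊆ x + H`, `Y ⊆ y + H` and `|X| + |Y| ≥ |H| + 1`, then `X + Y = x + y + H` («and thus
`A + B = a + b + H` by Proposition 2.1», type (III)); `H` carried as a finset.
[cite: Grynkiewicz2009, Prop 2.1 (i); §2 (type (III))] -/
theorem add_eq_vadd_carrier_of_card_lt {X Y Hf : Finset G} {H : AddSubgroup G}
    (hHf : ∀ g, g ∈ Hf ↔ g ∈ H) {x y : G} (hX : X ⊆ x +ᵥ Hf) (hY : Y ⊆ y +ᵥ Hf)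
    (hcard : #Hf < #X + #Y) : X + Y = (x + y) +ᵥ Hf := by
  refine Subset.antisymm (fun z hz => ?_) (Grynkiewicz2009.vadd_subset_add_of_card_lt hHf hX hY hcard)
  obtain ⟨u, hu, v, hv, rfl⟩ := mem_add.1 hz
  obtain ⟨h₁, hh₁, rfl⟩ := mem_vadd_finset.1 (hX hu)
  obtain ⟨h₂, hh₂, rfl⟩ := mem_vadd_finset.1 (hY hv)
  refine mem_vadd_finset.2 ⟨h₁ + h₂, (hHf _).2 (H.add_mem ((hHf _).1 hh₁) ((hHf _).1 hh₂)), ?_⟩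
  simp only [vadd_eq_add]
  abel

/-! ### Type (III) -/

namespace IsElementaryIII

/-- Both members of a type (III) pair are nonempty. [cite: Grynkiewicz2009, §2 (type (III))] -/
theorem nonempty {A B : Finset G} (h : IsElementaryIII A B) : A.Nonempty ∧ B.Nonempty := by
  obtain ⟨-, a, b, ha, hb, -⟩ := h
  exact ⟨⟨a, ha⟩, ⟨b, hb⟩⟩

omit [DecidableEq G] in
/-- The subgroup of a type (III) pair is finite: `|H| = |A| + |B| − 1 ≥ 1`.
[cite: Grynkiewicz2009, §2 (type (III))] -/
theorem nat_card_ne_zero {A B : Finset G} {H : AddSubgroup G} {a b : G} (ha : a ∈ A) (hb : b ∈ B)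
    (hcard : #A + #B = Nat.card H + 1) : Nat.card H ≠ 0 := by
  intro h0
  rw [h0] at hcard
  have := card_pos.2 ⟨a, ha⟩
  have := card_pos.2 ⟨b, hb⟩
  omega

/-- «(and thus `A + B = a + b + H` by proposition 2.1)»: the sum of a type (III) pair is the full
coset, with the data unpacked and `H` carried as a finset. [cite: Grynkiewicz2009, §2 (type (III))] -/
theorem add_eq_of_data {A B Hf : Finset G} {H : AddSubgroup G} (hHf : ∀ g, g ∈ Hf ↔ g ∈ H)
    (hHfc : #Hf = Nat.card H) {a b : G} (hA : ∀ x ∈ A, x - a ∈ H) (hB : ∀ y ∈ B, y - b ∈ H)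
    (hcard : #A + #B = Nat.card H + 1) : A + B = (a + b) +ᵥ Hf :=
  add_eq_vadd_carrier_of_card_lt hHf (subset_vadd_carrier_of_sub_mem hHf hA)
    (subset_vadd_carrier_of_sub_mem hHf hB) (by omega)

/-- «Note, in all four cases, that `|A + B| = |A| + |B| − 1`»: type (III) (`|A + B| = |H|`).
[cite: Grynkiewicz2009, §2 (elementary pairs)] -/
theorem card_add {A B : Finset G} (h : IsElementaryIII A B) : #(A + B) + 1 = #A + #B := by
  obtain ⟨H, a, b, ha, hb, hA, hB, hcard, -⟩ := h
  obtain ⟨Hf, hHf, hHfc⟩ :=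
    exists_finset_carrier (finite_coe_of_nat_card_ne_zero (nat_card_ne_zero ha hb hcard))
  rw [add_eq_of_data hHf hHfc hA hB hcard, card_vadd_finset]
  omega

/-- A type (III) pair has the unique expression element `a + b`, `a ∈ A`, `b ∈ B`.
[cite: Grynkiewicz2009, §2 (type (III))] -/
theorem exists_addConvolution_eq_one {A B : Finset G} (h : IsElementaryIII A B) :
    ∃ a ∈ A, ∃ b ∈ B, A.addConvolution B (a + b) = 1 := by
  obtain ⟨-, a, b, ha, hb, -, -, -, huniq⟩ := h
  exact ⟨a, ha, b, hb, (huniq _).2 rfl⟩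

/-- «the additional conditions on unique expression elements for type (III) … pairs imply
`|A|, |B| ≥ 3` (see [10] [28])» — for a NONTRIVIAL subgroup `H`; the printed definition also admits
the degenerate pair `({a}, {b})` with `H` trivial, which we list as the alternative `|A| = |B| = 1`.
(`|A| = 1` makes every element of `A + B` a unique expression element, so `A + B = {a + b}` and
`|B| = 1`; `|A| = 2` gives `|B| = |H| − 1`, `|A + B| = |H|` and, counting `Σ_x r_{A,B}(x) = 2|B|`
with `r ≤ 2`, exactly two unique expression elements.) [cite: Grynkiewicz2009, §2 (elementary pairs)] -/
theorem card_eq_one_or_three_le {A B : Finset G} (h : IsElementaryIII A B) :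
    (#A = 1 ∧ #B = 1) ∨ (3 ≤ #A ∧ 3 ≤ #B) := by
  have hAB := h.card_add
  obtain ⟨H, a, b, ha, hb, hA, hB, hcard, huniq⟩ := h
  have hApos := card_pos.2 ⟨a, ha⟩
  have hBpos := card_pos.2 ⟨b, hb⟩
  -- the unique expression elements of `A + B` are exactly `{a + b}`
  have hU : (A + B).filter (fun x => A.addConvolution B x = 1) = {a + b} := by
    ext x
    rw [mem_filter, mem_singleton]
    constructor
    · exact fun hx => (huniq x).1 hx.2
    · rintro rfl
      exact ⟨add_mem_add ha hb, (huniq _).2 rfl⟩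
  -- `|A| = 1` forces `|B| = 1`, and symmetrically
  have one : ∀ {X Y : Finset G}, Y.Nonempty →
      #((X + Y).filter fun x => X.addConvolution Y x = 1) = 1 → #X = 1 → #Y = 1 := by
    intro X Y hY hU1 hX1
    obtain ⟨c, rfl⟩ := card_eq_one.1 hX1
    have hI : IsElementaryI {c} Y := ⟨singleton_nonempty c, hY, Or.inl (card_singleton c)⟩
    have hall : (({c} : Finset G) + Y).filter (fun x => ({c} : Finset G).addConvolution Y x = 1) =
        {c} + Y := filter_true_of_mem fun x hx => hI.addConvolution_eq_one hx
    rw [hall, singleton_add, card_vadd_finset] at hU1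
    exact hU1
  -- `|A| = 2` is impossible, and symmetrically
  have two : ∀ {X Y : Finset G}, #(X + Y) + 1 = #X + #Y →
      #((X + Y).filter fun x => X.addConvolution Y x = 1) = 1 → #X ≠ 2 := by
    intro X Y hXY hU1 hX2
    have := two_mul_card_add_eq_of_card_eq_two (B := Y) hX2
    omega
  have hUc : #((A + B).filter fun x => A.addConvolution B x = 1) = 1 := by
    rw [hU, card_singleton]
  have hUc' : #((B + A).filter fun x => B.addConvolution A x = 1) = 1 := by
    have : (B + A).filter (fun x => B.addConvolution A x = 1) =
        (A + B).filter (fun x => A.addConvolution B x = 1) := by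
      rw [add_comm B A]
      refine filter_congr fun x _ => ?_
      rw [Grynkiewicz2009.addConvolution_comm]
    rw [this, hUc]
  have hBA : #(B + A) + 1 = #B + #A := by rw [add_comm B A]; omega
  have h1 := one ⟨b, hb⟩ hUc
  have h1' := one ⟨a, ha⟩ hUc'
  have h2 := two hAB hUc
  have h2' := two hBA hUc'
  omega

end IsElementaryIII

/-! ### Type (IV) -/

namespace IsElementaryIV

/-- Both members of a type (IV) pair are nonempty. [cite: Grynkiewicz2009, §2 (type (IV))] -/
theorem nonempty {A B : Finset G} (h : IsElementaryIV A B) : A.Nonempty ∧ B.Nonempty := by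
  obtain ⟨-, a, b, -, ha, hb, -⟩ := h
  exact ⟨⟨a, ha⟩, ⟨b, hb⟩⟩

/-- The subgroup of a type (IV) pair is finite: `b + H ⊆ B ∪ (g − A)`.
[cite: Grynkiewicz2009, §2 (type (IV))] -/
theorem finite_of_data {A B : Finset G} {H : AddSubgroup G} {b g : G}
    (hAg : ∀ x, x ∈ A ↔ (g - x) - b ∈ H ∧ g - x ∉ B) : (H : Set G).Finite := by
  refine Set.Finite.subset (finite_toSet ((B ∪ A.image fun x => g - x).image fun y => y - b))
    fun h hh => ?_
  rw [mem_coe, mem_image]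
  refine ⟨b + h, ?_, by rw [add_sub_cancel_left]⟩
  by_cases hbh : b + h ∈ B
  · exact mem_union_left _ hbh
  · refine mem_union_right _ (mem_image.2 ⟨g - (b + h), (hAg _).2 ⟨?_, ?_⟩, sub_sub_cancel _ _⟩)
    · rw [sub_sub_cancel, add_sub_cancel_left]; exact hh
    · rw [sub_sub_cancel]; exact hbh

/-- **Type (IV), the structure of the sum** (data unpacked, `H` carried as a finset): `|A| + |B| = |H|`,
`g ∈ a + b + H`, and `A + B = (a + b + H) ∖ {g}` — only `B` aperiodic is used («in particular, we have
`|A + B| = |H| − 1` when `(A, B)` has type (IV)»: `g ∉ A + B` since `g − x ∉ B` for `x ∈ A`, and every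
other `z = g + k`, `0 ≠ k ∈ H`, is `x + y` with `y ∈ B`, `y − k ∉ B`, which exists as `B` is not
`⟨k⟩`-periodic). [cite: Grynkiewicz2009, §2 (elementary pairs, type (IV))] -/
theorem add_eq_of_data {A B Hf : Finset G} {H : AddSubgroup G} (hHf : ∀ g, g ∈ Hf ↔ g ∈ H)
    {a b g : G} (ha : a ∈ A) (hA : ∀ x ∈ A, x - a ∈ H) (hB : ∀ y ∈ B, y - b ∈ H)
    (hBap : ¬ IsPeriodic B) (hAg : ∀ x, x ∈ A ↔ (g - x) - b ∈ H ∧ g - x ∉ B) :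
    #A + #B = #Hf ∧ g ∈ (a + b) +ᵥ Hf ∧ g ∉ A + B ∧ A + B = ((a + b) +ᵥ Hf).erase g := by
  have hBsub : B ⊆ b +ᵥ Hf := subset_vadd_carrier_of_sub_mem hHf hB
  have hAsub : A ⊆ a +ᵥ Hf := subset_vadd_carrier_of_sub_mem hHf hA
  -- `A = g − ((b + H) ∖ B)`
  have hAeq : A = ((b +ᵥ Hf) \ B).image fun y => g - y := by
    ext x
    rw [mem_image]
    constructor
    · intro hx
      obtain ⟨h1, h2⟩ := (hAg x).1 hx
      exact ⟨g - x, mem_sdiff.2 ⟨mem_vadd_finset.2 ⟨g - x - b, (hHf _).2 h1, by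
        rw [vadd_eq_add, add_sub_cancel]⟩, h2⟩, sub_sub_cancel g x⟩
    · rintro ⟨y, hy, rfl⟩
      rw [mem_sdiff] at hy
      obtain ⟨k, hk, rfl⟩ := mem_vadd_finset.1 hy.1
      refine (hAg _).2 ⟨?_, ?_⟩
      · rw [sub_sub_cancel, vadd_eq_add, add_sub_cancel_left]; exact (hHf k).1 hk
      · rw [sub_sub_cancel]; exact hy.2
  have hcardA : #A + #B = #Hf := by
    have h1 : #A = #((b +ᵥ Hf) \ B) := by
      rw [hAeq, card_image_of_injective _ sub_right_injective]
    have h2 := card_sdiff_add_card_eq_card hBsub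
    rw [card_vadd_finset] at h2
    omega
  -- `g ∈ a + b + H`
  have hg : g ∈ (a + b) +ᵥ Hf := by
    obtain ⟨h1, -⟩ := (hAg a).1 ha
    refine mem_vadd_finset.2 ⟨g - a - b, (hHf _).2 h1, ?_⟩
    rw [vadd_eq_add]; abel
  -- `g ∉ A + B`
  have hgAB : g ∉ A + B := by
    intro hmem
    obtain ⟨x, hx, y, hy, hxy⟩ := mem_add.1 hmem
    have : g - x = y := by rw [← hxy]; abel
    exact ((hAg x).1 hx).2 (this ▸ hy)
  refine ⟨hcardA, hg, hgAB, Subset.antisymm (fun z hz => ?_) (fun z hz => ?_)⟩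
  · refine mem_erase.2 ⟨fun hzg => hgAB (hzg ▸ hz), ?_⟩
    obtain ⟨x, hx, y, hy, rfl⟩ := mem_add.1 hz
    obtain ⟨h₁, hh₁, rfl⟩ := mem_vadd_finset.1 (hAsub hx)
    obtain ⟨h₂, hh₂, rfl⟩ := mem_vadd_finset.1 (hBsub hy)
    refine mem_vadd_finset.2 ⟨h₁ + h₂, (hHf _).2 (H.add_mem ((hHf _).1 hh₁) ((hHf _).1 hh₂)), ?_⟩
    simp only [vadd_eq_add]; abel
  · obtain ⟨hzg, hz⟩ := mem_erase.1 hz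
    -- `k = z − g ∈ H ∖ {0}`
    have hkH : z - g ∈ H := by
      obtain ⟨h₁, hh₁, rfl⟩ := mem_vadd_finset.1 hz
      obtain ⟨h₂, hh₂, rfl⟩ := mem_vadd_finset.1 hg
      have e : ((a + b) +ᵥ h₁) - ((a + b) +ᵥ h₂) = h₁ - h₂ := by simp only [vadd_eq_add]; abel
      rw [e]; exact H.sub_mem ((hHf _).1 hh₁) ((hHf _).1 hh₂)
    have hk0 : z - g ≠ 0 := fun h0 => hzg (sub_eq_zero.1 h0)
    -- some `y ∈ B` has `y − k ∉ B`, as `B` is not `⟨k⟩`-periodic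
    obtain ⟨y, hy, hyk⟩ : ∃ y ∈ B, y - (z - g) ∉ B := by
      by_contra hne
      push Not at hne
      have hsub : -(z - g) +ᵥ B ⊆ B := by
        intro w hw
        obtain ⟨y, hy, rfl⟩ := mem_vadd_finset.1 hw
        rw [vadd_eq_add, neg_add_eq_sub]; exact hne y hy
      have heq : -(z - g) +ᵥ B = B := eq_of_subset_of_card_le hsub (by rw [card_vadd_finset])
      refine hBap ⟨AddSubgroup.zmultiples (-(z - g)), ?_, isPeriodicWith_zmultiples_of_vadd_eq heq⟩
      rw [Ne, AddSubgroup.zmultiples_eq_bot, neg_eq_zero]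
      exact hk0
    refine mem_add.2 ⟨z - y, (hAg _).2 ⟨?_, ?_⟩, y, hy, sub_add_cancel z y⟩
    · have e : g - (z - y) - b = (y - b) - (z - g) := by abel
      rw [e]; exact H.sub_mem (hB y hy) hkH
    · have e : g - (z - y) = y - (z - g) := by abel
      rw [e]; exact hyk

/-- «in particular, we have `|A + B| = |H| − 1` when `(A, B)` has type (IV)» and «`|A + B| =
|A| + |B| − 1`» (data unpacked, `H` carried as a finset). [cite: Grynkiewicz2009, §2 (elementary pairs)] -/
theorem card_add_of_data {A B Hf : Finset G} {H : AddSubgroup G} (hHf : ∀ g, g ∈ Hf ↔ g ∈ H)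
    {a b g : G} (ha : a ∈ A) (hA : ∀ x ∈ A, x - a ∈ H) (hB : ∀ y ∈ B, y - b ∈ H)
    (hBap : ¬ IsPeriodic B) (hAg : ∀ x, x ∈ A ↔ (g - x) - b ∈ H ∧ g - x ∉ B) :
    #(A + B) + 1 = #Hf ∧ #A + #B = #Hf := by
  obtain ⟨hc, hg, -, heq⟩ := add_eq_of_data hHf ha hA hB hBap hAg
  refine ⟨?_, hc⟩
  rw [heq, card_erase_of_mem hg, card_vadd_finset]
  have := card_pos.2 ⟨g, hg⟩
  rw [card_vadd_finset] at this
  omega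

/-- «Note, in all four cases, that `|A + B| = |A| + |B| − 1`»: type (IV).
[cite: Grynkiewicz2009, §2 (elementary pairs)] -/
theorem card_add {A B : Finset G} (h : IsElementaryIV A B) : #(A + B) + 1 = #A + #B := by
  obtain ⟨H, a, b, g, ha, -, hA, hB, -, -, hBap, hAg⟩ := h
  obtain ⟨Hf, hHf, -⟩ := exists_finset_carrier (finite_of_data hAg)
  obtain ⟨h1, h2⟩ := card_add_of_data hHf ha hA hB hBap hAg
  omega

/-- «in particular, we have `|A + B| = |H| − 1` when `(A, B)` has type (IV)», for the subgroup `H` of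
the definition. [cite: Grynkiewicz2009, §2 (elementary pairs)] -/
theorem exists_card_add_succ_eq {A B : Finset G} (h : IsElementaryIV A B) :
    ∃ (H : AddSubgroup G) (a b g : G), a ∈ A ∧ b ∈ B ∧ (∀ x ∈ A, x - a ∈ H) ∧ (∀ y ∈ B, y - b ∈ H) ∧
      (∀ x, x ∈ A ↔ (g - x) - b ∈ H ∧ g - x ∉ B) ∧ #(A + B) + 1 = Nat.card H ∧ #A + #B = Nat.card H := by
  obtain ⟨H, a, b, g, ha, hb, hA, hB, -, -, hBap, hAg⟩ := h
  obtain ⟨Hf, hHf, hHfc⟩ := exists_finset_carrier (finite_of_data hAg)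
  obtain ⟨h1, h2⟩ := card_add_of_data hHf ha hA hB hBap hAg
  exact ⟨H, a, b, g, ha, hb, hA, hB, hAg, by rw [← hHfc]; exact h1, by rw [← hHfc]; exact h2⟩

/-- The sum of a type (IV) pair is a punctured coset `(a + b + H) ∖ {g}`, hence NOT periodic («a
punctured periodic set cannot be periodic», print p. 69; here `|H| ≥ 2` because `A + B ≠ ∅`).
[cite: Grynkiewicz2009, §2 (type (IV); punctured periodic sets)] -/
theorem not_isPeriodic_add {A B : Finset G} (h : IsElementaryIV A B) : ¬ IsPeriodic (A + B) := by
  obtain ⟨H, a, b, g, ha, hb, hA, hB, -, -, hBap, hAg⟩ := h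
  obtain ⟨Hf, hHf, -⟩ := exists_finset_carrier (finite_of_data hAg)
  obtain ⟨hc, hg, hgAB, heq⟩ := add_eq_of_data hHf ha hA hB hBap hAg
  have hne : (A + B).Nonempty := ⟨a + b, add_mem_add ha hb⟩
  have hH : H ≠ ⊥ := by
    intro hbot
    have hsub : Hf ⊆ {0} := fun x hx => by
      have := (hHf x).1 hx
      rw [hbot, AddSubgroup.mem_bot] at this
      exact mem_singleton.2 this
    have h1 := card_le_card hsub
    rw [card_singleton] at h1
    have h2 := hne.card_pos
    rw [heq, card_erase_of_mem hg, card_vadd_finset] at h2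
    omega
  have hins : insert g (A + B) = (a + b) +ᵥ Hf := by rw [heq, insert_erase hg]
  exact not_isPeriodic_of_isPeriodicWith_insert hH hgAB (hins ▸ isPeriodicWith_vadd_carrier hHf _) hne

/-- «the additional conditions on unique expression elements for type … (IV) pairs imply
`|A|, |B| ≥ 3` (see [10] [28])»: `|A| = 1` would make every element of `A + B ≠ ∅` a unique expression
element; `|A| = 2` would give `r_{A,B} ≡ 2` on `A + B`, i.e. `|A + B| = |B|`, against
`|A + B| = |A| + |B| − 1 = |B| + 1`; symmetrically for `B`. [cite: Grynkiewicz2009, §2 (elementary pairs)] -/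
theorem three_le_card {A B : Finset G} (h : IsElementaryIV A B) : 3 ≤ #A ∧ 3 ≤ #B := by
  have hAB := h.card_add
  obtain ⟨H, a, b, g, ha, hb, -, -, hnone, -⟩ := h
  have hBA : #(B + A) + 1 = #B + #A := by rw [add_comm B A]; omega
  have hU : (A + B).filter (fun x => A.addConvolution B x = 1) = ∅ :=
    filter_false_of_mem fun x _ => hnone x
  have hU' : (B + A).filter (fun x => B.addConvolution A x = 1) = ∅ :=
    filter_false_of_mem fun x _ => by rw [Grynkiewicz2009.addConvolution_comm]; exact hnone x
  have one : ∀ {X Y : Finset G} {x y : G}, x ∈ X → y ∈ Y → (∀ z, X.addConvolution Y z ≠ 1) →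
      #X ≠ 1 := by
    intro X Y x y hx hy hn hX1
    have hI : IsElementaryI X Y := ⟨⟨x, hx⟩, ⟨y, hy⟩, Or.inl hX1⟩
    exact hn _ (hI.addConvolution_eq_one (add_mem_add hx hy))
  have two : ∀ {X Y : Finset G}, #(X + Y) + 1 = #X + #Y →
      (X + Y).filter (fun x => X.addConvolution Y x = 1) = ∅ → #X ≠ 2 := by
    intro X Y hXY hU0 hX2
    have := two_mul_card_add_eq_of_card_eq_two (B := Y) hX2
    rw [hU0, card_empty] at this
    omega
  have h1 := one ha hb hnone
  have h1' := one hb ha fun z => by rw [Grynkiewicz2009.addConvolution_comm]; exact hnone z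
  have h2 := two hAB hU
  have h2' := two hBA hU'
  have := card_pos.2 ⟨a, ha⟩
  have := card_pos.2 ⟨b, hb⟩
  omega

end IsElementaryIV

/-! ### Elementary pairs -/

namespace IsElementaryPair

/-- «Note, in all four cases, that `|A + B| = |A| + |B| − 1` for an elementary pair `(A, B)`».
[cite: Grynkiewicz2009, §2 (elementary pairs)] -/
theorem card_add {A B : Finset G} (h : IsElementaryPair A B) : #(A + B) + 1 = #A + #B := by
  rcases h with h | h | h | h
  · exact h.card_add
  · exact h.card_add
  · exact h.card_add
  · exact h.card_add

/-- Both members of an elementary pair are nonempty. [cite: Grynkiewicz2009, §2 (elementary pairs)] -/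
theorem nonempty {A B : Finset G} (h : IsElementaryPair A B) : A.Nonempty ∧ B.Nonempty := by
  rcases h with h | h | h | h
  · exact h.nonempty
  · exact ⟨card_pos.1 (by have := h.1; omega), card_pos.1 (by have := h.2.1; omega)⟩
  · exact h.nonempty
  · exact h.nonempty

/-- An elementary pair of type (I), (II) or (III) has a unique expression element; one of type (IV)
has none (by definition). [cite: Grynkiewicz2009, §2 (elementary pairs)] -/
theorem exists_addConvolution_eq_one_or {A B : Finset G} (h : IsElementaryPair A B) :
    (∃ a ∈ A, ∃ b ∈ B, A.addConvolution B (a + b) = 1) ∨ IsElementaryIV A B := by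
  rcases h with h | h | h | h
  · exact Or.inl h.exists_addConvolution_eq_one
  · exact Or.inl h.exists_addConvolution_eq_one
  · exact Or.inl h.exists_addConvolution_eq_one
  · exact Or.inr h

end IsElementaryPair

/-! ### Quasi-periodic decompositions: the two parts meet different cosets -/

namespace IsQuasiPeriodicDecomp

variable {H : AddSubgroup G} {A A₁ A₀ : Finset G}

/-- In a quasi-periodic decomposition with `A₀ ≠ ∅`, no element of the periodic part `A₁` is congruent
modulo `H` to an element of `A₀` (else `A₀`'s coset would lie in `A₁`). [cite: Grynkiewicz2009, §2] -/
theorem sub_notMem (hd : IsQuasiPeriodicDecomp H A A₁ A₀) {x y : G} (hx : x ∈ A₁) (hy : y ∈ A₀) :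
    x - y ∉ H := by
  intro hxy
  have : y ∈ A₁ := by
    have := hd.periodic.add_mem (H.neg_mem hxy) hx
    rwa [neg_sub, sub_add_cancel] at this
  exact disjoint_left.1 hd.disjoint this hy

/-- An element of `A` congruent modulo `H` to an element of `A₀` lies in `A₀`. [cite: Grynkiewicz2009, §2] -/
theorem mem_right_of_sub_mem (hd : IsQuasiPeriodicDecomp H A A₁ A₀) {x y : G} (hx : x ∈ A)
    (hy : y ∈ A₀) (hxy : x - y ∈ H) : x ∈ A₀ := by
  rw [← hd.union_eq, mem_union] at hx
  exact hx.resolve_left fun hx1 => hd.sub_notMem hx1 hy hxy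

/-- `|φ_H(A)| = |φ_H(A₁)| + 1` when `A₀ ≠ ∅`. [cite: Grynkiewicz2009, §2] -/
theorem cosetCount_eq (hd : IsQuasiPeriodicDecomp H A A₁ A₀) (hne : A₀.Nonempty) :
    cosetCount H A = cosetCount H A₁ + 1 := by
  rw [← hd.union_eq, cosetCount_union (fun x hx y hy => hd.sub_notMem hx hy),
    cosetCount_eq_one_of_sub_mem hne hd.sub_mem]

end IsQuasiPeriodicDecomp

/-- **Condition (i) in the quotient.**  For quasi-periodic decompositions `A = A₁ ∪ A₀`, `B = B₁ ∪ B₀`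
with quasi-period `H` and `a₀ ∈ A₀`, `b₀ ∈ B₀`, the elementwise rendering of (i) used below is
equivalent to «`φ_H(A₀) + φ_H(B₀)` is a unique expression element in `φ_H(A) + φ_H(B)`», i.e.
`r_{φ_H(A), φ_H(B)}(φ_H(a₀) + φ_H(b₀)) = 1` in `G ⧸ H`. [cite: Grynkiewicz2009, §2 (KST (i))] -/
theorem quot_unique_iff_addConvolution_image {H : AddSubgroup G} [DecidableEq (G ⧸ H)]
    {A B A₁ A₀ B₁ B₀ : Finset G} (hdA : IsQuasiPeriodicDecomp H A A₁ A₀)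
    (hdB : IsQuasiPeriodicDecomp H B B₁ B₀) {a₀ b₀ : G} (ha₀ : a₀ ∈ A₀) (hb₀ : b₀ ∈ B₀) :
    (∀ a ∈ A, ∀ b ∈ B, ∀ a₀' ∈ A₀, ∀ b₀' ∈ B₀, (a + b) - (a₀' + b₀') ∈ H →
        a - a₀' ∈ H ∧ b - b₀' ∈ H) ↔
      (A.image (QuotientAddGroup.mk : G → G ⧸ H)).addConvolution
          (B.image (QuotientAddGroup.mk : G → G ⧸ H)) (QuotientAddGroup.mk (a₀ + b₀)) = 1 := by
  have hmkA : (QuotientAddGroup.mk a₀ : G ⧸ H) ∈ A.image (QuotientAddGroup.mk : G → G ⧸ H) :=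
    mem_image_of_mem _ (hdA.right_subset ha₀)
  have hmkB : (QuotientAddGroup.mk b₀ : G ⧸ H) ∈ B.image (QuotientAddGroup.mk : G → G ⧸ H) :=
    mem_image_of_mem _ (hdB.right_subset hb₀)
  rw [QuotientAddGroup.mk_add, addConvolution_add_eq_one_iff hmkA hmkB]
  constructor
  · intro h ξ hξ η hη he
    obtain ⟨a, ha, rfl⟩ := mem_image.1 hξ
    obtain ⟨b, hb, rfl⟩ := mem_image.1 hη
    rw [← QuotientAddGroup.mk_add, ← QuotientAddGroup.mk_add, QuotientAddGroup.eq_iff_sub_mem] at he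
    exact QuotientAddGroup.eq_iff_sub_mem.2 (h a ha b hb a₀ ha₀ b₀ hb₀ he).2
  · intro h a ha b hb a₀' ha₀' b₀' hb₀' hab
    have hab' : (a + b) - (a₀ + b₀) ∈ H := by
      have e : (a + b) - (a₀ + b₀) = ((a + b) - (a₀' + b₀')) + ((a₀' - a₀) + (b₀' - b₀)) := by abel
      rw [e]
      exact H.add_mem hab (H.add_mem (hdA.sub_mem _ ha₀' _ ha₀) (hdB.sub_mem _ hb₀' _ hb₀))
    have hb' : (QuotientAddGroup.mk b : G ⧸ H) = QuotientAddGroup.mk b₀ :=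
      h _ (mem_image_of_mem _ ha) _ (mem_image_of_mem _ hb)
        (by rw [← QuotientAddGroup.mk_add, ← QuotientAddGroup.mk_add, QuotientAddGroup.eq_iff_sub_mem]
            exact hab')
    have hbH : b - b₀ ∈ H := QuotientAddGroup.eq_iff_sub_mem.1 hb'
    have haH : a - a₀ ∈ H := by
      have e : a - a₀ = ((a + b) - (a₀ + b₀)) - (b - b₀) := by abel
      rw [e]
      exact H.sub_mem hab' hbH
    refine ⟨?_, ?_⟩
    · have e : a - a₀' = (a - a₀) + (a₀ - a₀') := by abel
      rw [e]
      exact H.add_mem haH (hdA.sub_mem _ ha₀ _ ha₀')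
    · have e : b - b₀' = (b - b₀) + (b₀ - b₀') := by abel
      rw [e]
      exact H.add_mem hbH (hdB.sub_mem _ hb₀ _ hb₀')

/-! ### Kemperman decompositions (the conditions (i)–(iv) of KST) -/

/-- **The decompositions of the Kemperman Structure Theorem.**  «there exist quasi-periodic
decompositions `A = A₁ ∪ A₀` and `B = B₁ ∪ B₀` with common quasi-period `H` and `A₀` and `B₀` nonempty,
such that: (i) `φ_H(A₀) + φ_H(B₀)` is a unique expression element in `φ_H(A) + φ_H(B)`;
(ii) `|φ_H(A + B)| = |φ_H(A)| + |φ_H(B)| − 1`; (iii) if `a + b ∈ A + B` is a unique expression element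
with `a ∈ A` and `b ∈ B`, then `a ∈ A₀` and `b ∈ B₀`; (iv) `(A₀, B₀)` is an elementary pair of type (I),
(II), (III) or (IV).»  Rendering: (i) elementwise — every `a ∈ A`, `b ∈ B` with
`φ_H(a) + φ_H(b) = φ_H(A₀) + φ_H(B₀)` has `φ_H(a) = φ_H(A₀)` and `φ_H(b) = φ_H(B₀)` (`A₀`, `B₀` lie in
single `H`-cosets; equivalent to `r_{φ_H(A),φ_H(B)}(φ_H(A₀) + φ_H(B₀)) = 1`,
`quot_unique_iff_addConvolution_image`);
(ii) with `cosetCount H X = |φ_H(X)|`; (iii) with `r_{A,B}(a + b) = 1` as `A.addConvolution B (a + b) = 1`.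
[cite: Grynkiewicz2009, §2 (Kemperman Structure Theorem, (i)–(iv))] -/
structure IsKempermanDecomp (H : AddSubgroup G) (A B A₁ A₀ B₁ B₀ : Finset G) : Prop where
  /-- `A = A₁ ∪ A₀` is a quasi-periodic decomposition with quasi-period `H` -/
  decomp_left : IsQuasiPeriodicDecomp H A A₁ A₀
  /-- `B = B₁ ∪ B₀` is a quasi-periodic decomposition with quasi-period `H` -/
  decomp_right : IsQuasiPeriodicDecomp H B B₁ B₀
  /-- `A₀ ≠ ∅` -/
  left_nonempty : A₀.Nonempty
  /-- `B₀ ≠ ∅` -/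
  right_nonempty : B₀.Nonempty
  /-- (i) `φ_H(A₀) + φ_H(B₀)` is a unique expression element in `φ_H(A) + φ_H(B)` -/
  quot_unique : ∀ a ∈ A, ∀ b ∈ B, ∀ a₀ ∈ A₀, ∀ b₀ ∈ B₀, (a + b) - (a₀ + b₀) ∈ H →
    a - a₀ ∈ H ∧ b - b₀ ∈ H
  /-- (ii) `|φ_H(A + B)| = |φ_H(A)| + |φ_H(B)| − 1` -/
  cosetCount_add : cosetCount H (A + B) + 1 = cosetCount H A + cosetCount H B
  /-- (iii) unique expression elements `a + b` of `A + B` have `a ∈ A₀` and `b ∈ B₀` -/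
  mem_of_unique : ∀ a ∈ A, ∀ b ∈ B, A.addConvolution B (a + b) = 1 → a ∈ A₀ ∧ b ∈ B₀
  /-- (iv) `(A₀, B₀)` is an elementary pair of type (I), (II), (III) or (IV) -/
  elementary : IsElementaryPair A₀ B₀

namespace IsKempermanDecomp

variable {H : AddSubgroup G} {A B A₁ A₀ B₁ B₀ : Finset G}

/-- `A + B = (A₁ + B) ∪ (A₀ + B₁) ∪ (A₀ + B₀)`. [cite: Grynkiewicz2009, §2 (KST)] -/
theorem add_eq (h : IsKempermanDecomp H A B A₁ A₀ B₁ B₀) :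
    A + B = (A₁ + B ∪ (A₀ + B₁)) ∪ (A₀ + B₀) := by
  have hA := h.decomp_left.union_eq
  have hB := h.decomp_right.union_eq
  calc A + B = (A₁ ∪ A₀) + B := by rw [hA]
    _ = A₁ + B ∪ (A₀ + B) := union_add
    _ = A₁ + B ∪ (A₀ + (B₁ ∪ B₀)) := by rw [hB]
    _ = _ := by rw [add_union, union_assoc]

/-- The part `(A₁ + B) ∪ (A₀ + B₁)` of `A + B` is `H`-periodic. [cite: Grynkiewicz2009, §2 (KST)] -/
theorem isPeriodicWith_part (h : IsKempermanDecomp H A B A₁ A₀ B₁ B₀) :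
    IsPeriodicWith H (A₁ + B ∪ (A₀ + B₁)) :=
  (h.decomp_left.periodic.add_right B).union (h.decomp_right.periodic.add_left A₀)

/-- By (i), no element of `(A₁ + B) ∪ (A₀ + B₁)` is congruent modulo `H` to an element of `A₀ + B₀`:
the coset `φ_H(A₀) + φ_H(B₀)` of `A + B` is met only by `A₀ + B₀`. [cite: Grynkiewicz2009, §2 (KST (i))] -/
theorem sub_notMem (h : IsKempermanDecomp H A B A₁ A₀ B₁ B₀) {p c : G}
    (hp : p ∈ A₁ + B ∪ (A₀ + B₁)) (hc : c ∈ A₀ + B₀) : p - c ∉ H := by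
  intro hpc
  obtain ⟨a₀, ha₀, b₀, hb₀, rfl⟩ := mem_add.1 hc
  rcases mem_union.1 hp with hp | hp
  · obtain ⟨a₁, ha₁, b, hb, rfl⟩ := mem_add.1 hp
    exact h.decomp_left.sub_notMem ha₁ ha₀
      (h.quot_unique a₁ (h.decomp_left.left_subset ha₁) b hb a₀ ha₀ b₀ hb₀ hpc).1
  · obtain ⟨a, ha, b₁, hb₁, rfl⟩ := mem_add.1 hp
    exact h.decomp_right.sub_notMem hb₁ hb₀
      (h.quot_unique a (h.decomp_left.right_subset ha) b₁ (h.decomp_right.left_subset hb₁)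
        a₀ ha₀ b₀ hb₀ hpc).2

/-- The two parts of `A + B` are disjoint. [cite: Grynkiewicz2009, §2 (KST)] -/
theorem disjoint_parts (h : IsKempermanDecomp H A B A₁ A₀ B₁ B₀) :
    Disjoint (A₁ + B ∪ (A₀ + B₁)) (A₀ + B₀) :=
  disjoint_left.2 fun _ hp hc => h.sub_notMem hp hc (by rw [sub_self]; exact H.zero_mem)

/-- `A₀ + B₀` lies inside one `H`-coset. [cite: Grynkiewicz2009, §2 (KST)] -/
theorem sub_mem_of_mem_add (h : IsKempermanDecomp H A B A₁ A₀ B₁ B₀) :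
    ∀ x ∈ A₀ + B₀, ∀ y ∈ A₀ + B₀, x - y ∈ H := by
  intro x hx y hy
  obtain ⟨a, ha, b, hb, rfl⟩ := mem_add.1 hx
  obtain ⟨a', ha', b', hb', rfl⟩ := mem_add.1 hy
  have e : a + b - (a' + b') = (a - a') + (b - b') := by abel
  rw [e]
  exact H.add_mem (h.decomp_left.sub_mem a ha a' ha') (h.decomp_right.sub_mem b hb b' hb')

/-- So `A + B = ((A₁ + B) ∪ (A₀ + B₁)) ∪ (A₀ + B₀)` is itself a quasi-periodic decomposition with
quasi-period `H` and nonempty aperiodic part. [cite: Grynkiewicz2009, §2 (KST)] -/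
theorem isQuasiPeriodicDecomp_add (h : IsKempermanDecomp H A B A₁ A₀ B₁ B₀) :
    IsQuasiPeriodicDecomp H (A + B) (A₁ + B ∪ (A₀ + B₁)) (A₀ + B₀) where
  ne_bot := h.decomp_left.ne_bot
  disjoint := h.disjoint_parts
  union_eq := h.add_eq.symm
  periodic := h.isPeriodicWith_part
  sub_mem := h.sub_mem_of_mem_add

/-- `|φ_H(A + B)| = |φ_H((A₁ + B) ∪ (A₀ + B₁))| + 1`. [cite: Grynkiewicz2009, §2 (KST)] -/
theorem cosetCount_add_eq (h : IsKempermanDecomp H A B A₁ A₀ B₁ B₀) :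
    cosetCount H (A + B) = cosetCount H (A₁ + B ∪ (A₀ + B₁)) + 1 :=
  h.isQuasiPeriodicDecomp_add.cosetCount_eq (h.left_nonempty.add h.right_nonempty)

/-- **KST, «if» direction, first half: `|A + B| = |A| + |B| − 1`.**  With `P = (A₁ + B) ∪ (A₀ + B₁)`:
`|A + B| = |P| + |A₀ + B₀| = |H|(|φ_H(A)| + |φ_H(B)| − 2) + |A₀| + |B₀| − 1 = |A| + |B| − 1`, by (ii),
`|X| = |φ_H(X)||H|` for the periodic parts, and `|A₀ + B₀| = |A₀| + |B₀| − 1` for the elementary pair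
(iv); if `H` is infinite the periodic parts are empty and `(A, B) = (A₀, B₀)`.
[cite: Grynkiewicz2009, §2 (Kemperman Structure Theorem)] -/
theorem card_add (h : IsKempermanDecomp H A B A₁ A₀ B₁ B₀) : #(A + B) + 1 = #A + #B := by
  have hC₀ := h.elementary.card_add
  have hcA := h.decomp_left.card_eq
  have hcB := h.decomp_right.card_eq
  have hsum : #(A + B) = #(A₁ + B ∪ (A₀ + B₁)) + #(A₀ + B₀) := by
    rw [h.add_eq, card_union_of_disjoint h.disjoint_parts]
  by_cases hfin : (H : Set G).Finite
  · obtain ⟨Hf, hHf, -⟩ := exists_finset_carrier hfin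
    have hP := card_eq_cosetCount_mul hHf h.isPeriodicWith_part
    have hA₁ := card_eq_cosetCount_mul hHf h.decomp_left.periodic
    have hB₁ := card_eq_cosetCount_mul hHf h.decomp_right.periodic
    have hii := h.cosetCount_add
    rw [h.cosetCount_add_eq, h.decomp_left.cosetCount_eq h.left_nonempty,
      h.decomp_right.cosetCount_eq h.right_nonempty] at hii
    have hcnt : cosetCount H (A₁ + B ∪ (A₀ + B₁)) = cosetCount H A₁ + cosetCount H B₁ := by omega
    rw [hcnt, add_mul] at hP
    omega
  · have hA₁ : A₁ = ∅ := by
      by_contra hne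
      exact hfin (finite_coe_of_isPeriodicWith h.decomp_left.periodic (nonempty_iff_ne_empty.2 hne))
    have hB₁ : B₁ = ∅ := by
      by_contra hne
      exact hfin (finite_coe_of_isPeriodicWith h.decomp_right.periodic (nonempty_iff_ne_empty.2 hne))
    simp only [hA₁, hB₁, empty_add, add_empty, empty_union, card_empty, zero_add] at hsum hcA hcB
    omega

/-- By (i), the representations in `A + B` of an element of `A₀ + B₀` all come from `A₀ × B₀`:
`r_{A,B}(a₀ + b₀) = r_{A₀,B₀}(a₀ + b₀)`. [cite: Grynkiewicz2009, §2 (KST (i))] -/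
theorem addConvolution_eq (h : IsKempermanDecomp H A B A₁ A₀ B₁ B₀) {a₀ b₀ : G} (ha₀ : a₀ ∈ A₀)
    (hb₀ : b₀ ∈ B₀) : A.addConvolution B (a₀ + b₀) = A₀.addConvolution B₀ (a₀ + b₀) := by
  rw [addConvolution_eq_card_filter, addConvolution_eq_card_filter]
  congr 1
  ext b
  simp only [mem_filter]
  constructor
  · rintro ⟨hb, hab⟩
    have hq := h.quot_unique (a₀ + b₀ - b) hab b hb a₀ ha₀ b₀ hb₀
      (by rw [sub_add_cancel, sub_self]; exact H.zero_mem)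
    exact ⟨h.decomp_right.mem_right_of_sub_mem hb hb₀ hq.2,
      h.decomp_left.mem_right_of_sub_mem hab ha₀ hq.1⟩
  · rintro ⟨hb, hab⟩
    exact ⟨h.decomp_right.right_subset hb, h.decomp_left.right_subset hab⟩

/-- If `(A₀, B₀)` has type (IV), then `A + B` is NOT periodic: with `C₀ = A₀ + B₀` (a punctured
`H'`-coset, not periodic) and `P = (A₁ + B) ∪ (A₀ + B₁)` (`H`-periodic, meeting other cosets than
`C₀`), a period `k ∈ H` of `A + B` would be a period of `C₀`, and a period `k ∉ H` would put
`k + C₀ ⊆ P`, hence `c + H ⊆ −k + P ⊆ A + B` for `c ∈ C₀`, making `C₀ = (A + B) ∩ (c + H)`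
`H`-periodic. [cite: Grynkiewicz2009, §2 (KST; punctured periodic sets)] -/
theorem not_isPeriodic_add (h : IsKempermanDecomp H A B A₁ A₀ B₁ B₀) (hIV : IsElementaryIV A₀ B₀) :
    ¬ IsPeriodic (A + B) := by
  have hC₀ := hIV.not_isPeriodic_add
  rintro ⟨K, hK, hper⟩
  obtain ⟨k, hkK, hk0⟩ : ∃ k ∈ K, k ≠ (0 : G) := by
    by_contra hne
    push Not at hne
    exact hK ((AddSubgroup.eq_bot_iff_forall _).2 hne)
  have hC₀ne : (A₀ + B₀).Nonempty := h.left_nonempty.add h.right_nonempty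
  have hkAB : ∀ c ∈ A₀ + B₀, ∀ k' ∈ K, k' + c ∈ A + B := fun c hc k' hk' =>
    hper.add_mem hk' (by rw [h.add_eq]; exact mem_union_right _ hc)
  have hmemC₀ : ∀ z ∈ A + B, ∀ c ∈ A₀ + B₀, z - c ∈ H → z ∈ A₀ + B₀ := by
    intro z hz c hc hzc
    rw [h.add_eq, mem_union] at hz
    exact hz.resolve_left fun hp => h.sub_notMem hp hc hzc
  by_cases hkH : k ∈ H
  · have hsub : k +ᵥ (A₀ + B₀) ⊆ A₀ + B₀ := by
      intro w hw
      obtain ⟨c, hc, rfl⟩ := mem_vadd_finset.1 hw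
      exact hmemC₀ _ (hkAB c hc k hkK) c hc (by rw [vadd_eq_add, add_sub_cancel_right]; exact hkH)
    have heq : k +ᵥ (A₀ + B₀) = A₀ + B₀ := eq_of_subset_of_card_le hsub (by rw [card_vadd_finset])
    refine hC₀ ⟨AddSubgroup.zmultiples k, ?_, isPeriodicWith_zmultiples_of_vadd_eq heq⟩
    rw [Ne, AddSubgroup.zmultiples_eq_bot]
    exact hk0
  · obtain ⟨c, hc⟩ := hC₀ne
    have hkc : k + c ∈ A₁ + B ∪ (A₀ + B₁) := by
      have := hkAB c hc k hkK
      rw [h.add_eq, mem_union] at this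
      refine this.resolve_right fun hkc => hkH ?_
      have := h.sub_mem_of_mem_add _ hkc c hc
      rwa [add_sub_cancel_right] at this
    have hall : ∀ x ∈ H, x + c ∈ A₀ + B₀ := by
      intro x hx
      have h1 : x + (k + c) ∈ A₁ + B ∪ (A₀ + B₁) := h.isPeriodicWith_part.add_mem hx hkc
      have h2 : -k + (x + (k + c)) ∈ A + B :=
        hper.add_mem (K.neg_mem hkK) (by rw [h.add_eq]; exact mem_union_left _ h1)
      have e : -k + (x + (k + c)) = x + c := by abel
      rw [e] at h2
      exact hmemC₀ _ h2 c hc (by rw [add_sub_cancel_right]; exact hx)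
    have hperC₀ : IsPeriodicWith H (A₀ + B₀) := by
      intro x hx
      refine eq_of_subset_of_card_le (fun w hw => ?_) (by rw [card_vadd_finset])
      obtain ⟨c', hc', rfl⟩ := mem_vadd_finset.1 hw
      have e : x +ᵥ c' = (x + (c' - c)) + c := by rw [vadd_eq_add]; abel
      rw [e]
      exact hall _ (H.add_mem hx (h.sub_mem_of_mem_add c' hc' c hc))
    exact hC₀ ⟨H, h.decomp_left.ne_bot, hperC₀⟩

/-- **KST, «if» direction, second half: `A + B` is aperiodic or contains a unique expression element**
— a unique expression element of the elementary pair `(A₀, B₀)` (types (I)–(III)) is one of `A + B`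
by (i); for type (IV), `A + B` is not periodic (`not_isPeriodic_add`).
[cite: Grynkiewicz2009, §2 (Kemperman Structure Theorem)] -/
theorem not_isPeriodic_or_exists (h : IsKempermanDecomp H A B A₁ A₀ B₁ B₀) :
    ¬ IsPeriodic (A + B) ∨ ∃ x, A.addConvolution B x = 1 := by
  rcases h.elementary.exists_addConvolution_eq_one_or with ⟨a₀, ha₀, b₀, hb₀, h1⟩ | hIV
  · exact Or.inr ⟨a₀ + b₀, by rw [h.addConvolution_eq ha₀ hb₀]; exact h1⟩
  · exact Or.inl (h.not_isPeriodic_add hIV)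

end IsKempermanDecomp

/-- **Kemperman Structure Theorem, the «if» direction** («Let `G` be a finite abelian group, and let
`A, B ⊆ G` be finite and nonempty.  Now `|A + B| = |A| + |B| − 1` and either `A + B` is aperiodic or
contains a unique expression element if and only if there exist quasi-periodic decompositions
`A = A₁ ∪ A₀` and `B = B₁ ∪ B₀` with common quasi-period `H` and `A₀` and `B₀` nonempty, such that
(i)–(iv)»): the existence of such decompositions implies `|A + B| = |A| + |B| − 1` and (`A + B` not
periodic or `r_{A,B}(x) = 1` for some `x`).  Proved here for every abelian group; the «only if»
direction (Kemperman 1960 [28], in this form Grynkiewicz 2005 [10] [11]) is NOT in this file — the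
tree's form of Kemperman's theorem is the Boothby–DeVos–Montejano chain `kemperman_structure_chain` /
`kemperman_critical_pair` of `KempermanStructureTheorem.lean`.
[cite: Grynkiewicz2009, §2 (Kemperman Structure Theorem)] -/
theorem card_add_and_of_exists_isKempermanDecomp {A B : Finset G}
    (h : ∃ (H : AddSubgroup G) (A₁ A₀ B₁ B₀ : Finset G), IsKempermanDecomp H A B A₁ A₀ B₁ B₀) :
    #(A + B) + 1 = #A + #B ∧ (¬ IsPeriodic (A + B) ∨ ∃ x, A.addConvolution B x = 1) := by
  obtain ⟨H, A₁, A₀, B₁, B₀, hK⟩ := h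
  exact ⟨hK.card_add, hK.not_isPeriodic_or_exists⟩

/-! ### Invariance under translation, negation and interchanging the summands

«By translating and considering `−A` and `−B` if necessary, we may w.l.o.g. assume …» (the standing
normalisation of §§5–6): the notions of this file are invariant under `(A, B) ↦ (g + A, g' + B)`,
`(A, B) ↦ (−A, −B)` and `(A, B) ↦ (B, A)`. [cite: Grynkiewicz2009, §2; §5 (proof of Lemma 5.10)] -/

section Invariance

/-- `r_{g+A, g'+B}(x) = r_{A,B}(x − g − g')`. [cite: Grynkiewicz2009, §2] -/
theorem addConvolution_vadd_vadd (A B : Finset G) (g g' x : G) :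
    (g +ᵥ A).addConvolution (g' +ᵥ B) x = A.addConvolution B (x - g - g') := by
  rw [vadd_addConvolution_eq_addConvolution_neg_add, Grynkiewicz2009.addConvolution_comm,
    vadd_addConvolution_eq_addConvolution_neg_add, Grynkiewicz2009.addConvolution_comm]
  congr 1
  abel

/-- `r_{−A,−B}(x) = r_{A,B}(−x)`. [cite: Grynkiewicz2009, §2] -/
theorem addConvolution_neg_neg (A B : Finset G) (x : G) :
    (-A).addConvolution (-B) x = A.addConvolution B (-x) := by
  rw [addConvolution_neg, Grynkiewicz2009.addConvolution_comm]

/-- `(g + A) + (g' + B) = (g + g') + (A + B)` (a private copy of `vadd_add_vadd_eq` of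
`KempermanNearSequences.lean`, not imported here). [cite: Grynkiewicz2009, §2] -/
private theorem vadd_finset_add_vadd_finset (A B : Finset G) (g g' : G) :
    (g +ᵥ A) + (g' +ᵥ B) = (g + g') +ᵥ (A + B) := by
  rw [vadd_add_assoc, add_comm A (g' +ᵥ B), vadd_add_assoc, vadd_vadd, add_comm B A]

/-- Periodicity is invariant under negation. [cite: Grynkiewicz2009, §2] -/
theorem isPeriodic_neg_iff {A : Finset G} : IsPeriodic (-A) ↔ IsPeriodic A := by
  constructor
  · rintro ⟨H, hH, hper⟩
    exact ⟨H, hH, by simpa using hper.neg⟩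
  · rintro ⟨H, hH, hper⟩
    exact ⟨H, hH, hper.neg⟩

/-- Periodicity is invariant under translation. [cite: Grynkiewicz2009, §2] -/
theorem isPeriodic_vadd_iff {A : Finset G} (g : G) : IsPeriodic (g +ᵥ A) ↔ IsPeriodic A :=
  ⟨fun h => by simpa using h.vadd (-g), fun h => h.vadd g⟩

/-- `|φ_H(g + X)| = |φ_H(X)|`. [cite: Grynkiewicz2009, §2] -/
theorem cosetCount_vadd (H : AddSubgroup G) (X : Finset G) (g : G) :
    cosetCount H (g +ᵥ X) = cosetCount H X := by
  classical
  rw [cosetCount_eq_card_image, cosetCount_eq_card_image]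
  have : (g +ᵥ X).image (QuotientAddGroup.mk : G → G ⧸ H) =
      (X.image (QuotientAddGroup.mk : G → G ⧸ H)).image fun q => (g : G ⧸ H) + q := by
    rw [image_image]
    ext q
    simp only [mem_image, mem_vadd_finset, Function.comp_apply]
    constructor
    · rintro ⟨y, ⟨x, hx, rfl⟩, rfl⟩
      exact ⟨x, hx, by rw [vadd_eq_add, QuotientAddGroup.mk_add]⟩
    · rintro ⟨x, hx, rfl⟩
      exact ⟨g +ᵥ x, ⟨x, hx, rfl⟩, by rw [vadd_eq_add, QuotientAddGroup.mk_add]⟩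
  rw [this, card_image_of_injective _ (add_right_injective _)]

/-- `|φ_H(−X)| = |φ_H(X)|`. [cite: Grynkiewicz2009, §2] -/
theorem cosetCount_neg (H : AddSubgroup G) (X : Finset G) : cosetCount H (-X) = cosetCount H X := by
  classical
  rw [cosetCount_eq_card_image, cosetCount_eq_card_image]
  have : (-X).image (QuotientAddGroup.mk : G → G ⧸ H) =
      (X.image (QuotientAddGroup.mk : G → G ⧸ H)).image fun q => -q := by
    rw [image_image]
    ext q
    simp only [mem_image, mem_neg', Function.comp_apply]
    constructor
    · rintro ⟨y, hy, rfl⟩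
      exact ⟨-y, hy, by rw [QuotientAddGroup.mk_neg, neg_neg]⟩
    · rintro ⟨x, hx, rfl⟩
      exact ⟨-x, by rw [neg_neg]; exact hx, by rw [QuotientAddGroup.mk_neg]⟩
  rw [this, card_image_of_injective _ neg_injective]

namespace IsElementaryI

omit [AddCommGroup G] [DecidableEq G] in
/-- Type (I) under a cardinality-preserving change of the sets. [cite: Grynkiewicz2009, §2 (type (I))] -/
theorem of_card_eq {A B : Finset G} {G' : Type*} {A' B' : Finset G'} (h : IsElementaryI A B)
    (hA : #A' = #A) (hB : #B' = #B) : IsElementaryI A' B' := by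
  obtain ⟨hAne, hBne, h1⟩ := h
  refine ⟨card_pos.1 (by rw [hA]; exact hAne.card_pos), card_pos.1 (by rw [hB]; exact hBne.card_pos),
    ?_⟩
  rw [hA, hB]; exact h1

/-- Type (I) is translation invariant. [cite: Grynkiewicz2009, §2 (type (I))] -/
theorem vadd {A B : Finset G} (h : IsElementaryI A B) (g g' : G) : IsElementaryI (g +ᵥ A) (g' +ᵥ B) :=
  h.of_card_eq (card_vadd_finset g A) (card_vadd_finset g' B)

/-- Type (I) is invariant under negation. [cite: Grynkiewicz2009, §2 (type (I))] -/
theorem neg {A B : Finset G} (h : IsElementaryI A B) : IsElementaryI (-A) (-B) :=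
  h.of_card_eq (card_neg A) (card_neg B)

end IsElementaryI

namespace IsElementaryII

/-- Type (II) is translation invariant. [cite: Grynkiewicz2009, §2 (type (II))] -/
theorem vadd {A B : Finset G} (h : IsElementaryII A B) (g g' : G) :
    IsElementaryII (g +ᵥ A) (g' +ᵥ B) := by
  obtain ⟨hA, hB, d, hAd, hBd, hord⟩ := h
  refine ⟨by rw [card_vadd_finset]; exact hA, by rw [card_vadd_finset]; exact hB, d, hAd.vadd g,
    hBd.vadd g', ?_⟩
  rw [card_vadd_finset, card_vadd_finset]; exact hord

/-- Type (II) is invariant under negation. [cite: Grynkiewicz2009, §2 (type (II))] -/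
theorem neg {A B : Finset G} (h : IsElementaryII A B) : IsElementaryII (-A) (-B) := by
  obtain ⟨hA, hB, d, hAd, hBd, hord⟩ := h
  refine ⟨by rw [card_neg]; exact hA, by rw [card_neg]; exact hB, d, hAd.neg, hBd.neg, ?_⟩
  rw [card_neg, card_neg]; exact hord

end IsElementaryII

namespace IsElementaryIII

/-- Type (III) is symmetric. [cite: Grynkiewicz2009, §2 (type (III))] -/
theorem symm {A B : Finset G} (h : IsElementaryIII A B) : IsElementaryIII B A := by
  obtain ⟨H, a, b, ha, hb, hA, hB, hcard, huniq⟩ := h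
  refine ⟨H, b, a, hb, ha, hB, hA, by omega, fun x => ?_⟩
  rw [Grynkiewicz2009.addConvolution_comm, huniq, add_comm]

/-- Type (III) is translation invariant. [cite: Grynkiewicz2009, §2 (type (III))] -/
theorem vadd {A B : Finset G} (h : IsElementaryIII A B) (g g' : G) :
    IsElementaryIII (g +ᵥ A) (g' +ᵥ B) := by
  obtain ⟨H, a, b, ha, hb, hA, hB, hcard, huniq⟩ := h
  refine ⟨H, g + a, g' + b, mem_vadd_finset.2 ⟨a, ha, rfl⟩, mem_vadd_finset.2 ⟨b, hb, rfl⟩, ?_, ?_,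
    by rw [card_vadd_finset, card_vadd_finset]; exact hcard, fun x => ?_⟩
  · intro x hx
    obtain ⟨y, hy, rfl⟩ := mem_vadd_finset.1 hx
    have e : (g +ᵥ y) - (g + a) = y - a := by rw [vadd_eq_add]; abel
    rw [e]; exact hA y hy
  · intro x hx
    obtain ⟨y, hy, rfl⟩ := mem_vadd_finset.1 hx
    have e : (g' +ᵥ y) - (g' + b) = y - b := by rw [vadd_eq_add]; abel
    rw [e]; exact hB y hy
  · rw [addConvolution_vadd_vadd, huniq]
    constructor
    · intro h1
      have : x = a + b + g + g' := by rw [← h1]; abel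
      rw [this]; abel
    · intro h1
      rw [h1]; abel

/-- Type (III) is invariant under negation. [cite: Grynkiewicz2009, §2 (type (III))] -/
theorem neg {A B : Finset G} (h : IsElementaryIII A B) : IsElementaryIII (-A) (-B) := by
  obtain ⟨H, a, b, ha, hb, hA, hB, hcard, huniq⟩ := h
  refine ⟨H, -a, -b, by rw [mem_neg', neg_neg]; exact ha, by rw [mem_neg', neg_neg]; exact hb, ?_, ?_,
    by rw [card_neg, card_neg]; exact hcard, fun x => ?_⟩
  · intro x hx
    rw [mem_neg'] at hx
    have e : x - -a = -(-x - a) := by abel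
    rw [e]; exact H.neg_mem (hA _ hx)
  · intro x hx
    rw [mem_neg'] at hx
    have e : x - -b = -(-x - b) := by abel
    rw [e]; exact H.neg_mem (hB _ hx)
  · rw [addConvolution_neg_neg, huniq]
    constructor
    · intro h1; rw [← neg_neg x, h1]; abel
    · intro h1; rw [h1]; abel

end IsElementaryIII

namespace IsElementaryIV

/-- Type (IV) is symmetric: `A = g − (b + H) ∖ B` iff `B = g − (a + H) ∖ A`.
[cite: Grynkiewicz2009, §2 (type (IV))] -/
theorem symm {A B : Finset G} (h : IsElementaryIV A B) : IsElementaryIV B A := by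
  obtain ⟨H, a, b, g, ha, hb, hA, hB, hnone, hAap, hBap, hAg⟩ := h
  have hgab : g - a - b ∈ H := ((hAg a).1 ha).1
  refine ⟨H, b, a, g, hb, ha, hB, hA, fun x => by rw [Grynkiewicz2009.addConvolution_comm]; exact hnone x,
    hBap, hAap, fun y => ?_⟩
  constructor
  · intro hy
    refine ⟨?_, fun hgy => ((hAg _).1 hgy).2 (by rw [sub_sub_cancel]; exact hy)⟩
    have e : g - y - a = (g - a - b) - (y - b) := by abel
    rw [e]; exact H.sub_mem hgab (hB y hy)
  · rintro ⟨h1, h2⟩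
    by_contra hy
    refine h2 ((hAg _).2 ⟨?_, by rw [sub_sub_cancel]; exact hy⟩)
    have e : g - (g - y) - b = (g - a - b) - (g - y - a) := by abel
    rw [e]; exact H.sub_mem hgab h1

/-- Type (IV) is translation invariant. [cite: Grynkiewicz2009, §2 (type (IV))] -/
theorem vadd {A B : Finset G} (h : IsElementaryIV A B) (c c' : G) :
    IsElementaryIV (c +ᵥ A) (c' +ᵥ B) := by
  obtain ⟨H, a, b, g, ha, hb, hA, hB, hnone, hAap, hBap, hAg⟩ := h
  refine ⟨H, c + a, c' + b, g + c + c', mem_vadd_finset.2 ⟨a, ha, rfl⟩, mem_vadd_finset.2 ⟨b, hb, rfl⟩,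
    ?_, ?_, fun x => by rw [addConvolution_vadd_vadd]; exact hnone _,
    fun hp => hAap ((isPeriodic_vadd_iff c).1 hp), fun hp => hBap ((isPeriodic_vadd_iff c').1 hp),
    fun x => ?_⟩
  · intro x hx
    obtain ⟨y, hy, rfl⟩ := mem_vadd_finset.1 hx
    have e : (c +ᵥ y) - (c + a) = y - a := by rw [vadd_eq_add]; abel
    rw [e]; exact hA y hy
  · intro x hx
    obtain ⟨y, hy, rfl⟩ := mem_vadd_finset.1 hx
    have e : (c' +ᵥ y) - (c' + b) = y - b := by rw [vadd_eq_add]; abel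
    rw [e]; exact hB y hy
  · have e1 : g + c + c' - x - (c' + b) = g - (-c + x) - b := by abel
    have e2 : g + c + c' - x = c' +ᵥ (g - (-c + x)) := by rw [vadd_eq_add]; abel
    have e3 : x ∈ c +ᵥ A ↔ -c + x ∈ A := by rw [← neg_vadd_mem_iff, vadd_eq_add]
    rw [e3, hAg, e1, e2, vadd_mem_vadd_finset_iff]

/-- Type (IV) is invariant under negation. [cite: Grynkiewicz2009, §2 (type (IV))] -/
theorem neg {A B : Finset G} (h : IsElementaryIV A B) : IsElementaryIV (-A) (-B) := by
  obtain ⟨H, a, b, g, ha, hb, hA, hB, hnone, hAap, hBap, hAg⟩ := h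
  refine ⟨H, -a, -b, -g, by rw [mem_neg', neg_neg]; exact ha, by rw [mem_neg', neg_neg]; exact hb,
    ?_, ?_, fun x => by rw [addConvolution_neg_neg]; exact hnone _,
    fun hp => hAap (isPeriodic_neg_iff.1 hp), fun hp => hBap (isPeriodic_neg_iff.1 hp), fun x => ?_⟩
  · intro x hx
    rw [mem_neg'] at hx
    have e : x - -a = -(-x - a) := by abel
    rw [e]; exact H.neg_mem (hA _ hx)
  · intro x hx
    rw [mem_neg'] at hx
    have e : x - -b = -(-x - b) := by abel
    rw [e]; exact H.neg_mem (hB _ hx)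
  · rw [mem_neg', hAg, mem_neg']
    have e1 : -g - x - -b = -(g - -x - b) := by abel
    have e2 : -(-g - x) = g - -x := by abel
    rw [e1, e2, H.neg_mem_iff]

end IsElementaryIV

namespace IsElementaryPair

/-- Elementary pairs are symmetric. [cite: Grynkiewicz2009, §2 (elementary pairs)] -/
theorem symm {A B : Finset G} (h : IsElementaryPair A B) : IsElementaryPair B A := by
  rcases h with h | h | h | h
  · exact Or.inl h.symm
  · exact Or.inr (Or.inl h.symm)
  · exact Or.inr (Or.inr (Or.inl h.symm))
  · exact Or.inr (Or.inr (Or.inr h.symm))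

/-- Elementary pairs are translation invariant. [cite: Grynkiewicz2009, §2 (elementary pairs)] -/
theorem vadd {A B : Finset G} (h : IsElementaryPair A B) (g g' : G) :
    IsElementaryPair (g +ᵥ A) (g' +ᵥ B) := by
  rcases h with h | h | h | h
  · exact Or.inl (h.vadd g g')
  · exact Or.inr (Or.inl (h.vadd g g'))
  · exact Or.inr (Or.inr (Or.inl (h.vadd g g')))
  · exact Or.inr (Or.inr (Or.inr (h.vadd g g')))

/-- Elementary pairs are invariant under negation. [cite: Grynkiewicz2009, §2 (elementary pairs)] -/
theorem neg {A B : Finset G} (h : IsElementaryPair A B) : IsElementaryPair (-A) (-B) := by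
  rcases h with h | h | h | h
  · exact Or.inl h.neg
  · exact Or.inr (Or.inl h.neg)
  · exact Or.inr (Or.inr (Or.inl h.neg))
  · exact Or.inr (Or.inr (Or.inr h.neg))

end IsElementaryPair

namespace IsKempermanDecomp

variable {H : AddSubgroup G} {A B A₁ A₀ B₁ B₀ : Finset G}

/-- Kemperman decompositions are symmetric in the two summands. [cite: Grynkiewicz2009, §2 (KST)] -/
theorem symm (h : IsKempermanDecomp H A B A₁ A₀ B₁ B₀) : IsKempermanDecomp H B A B₁ B₀ A₁ A₀ where
  decomp_left := h.decomp_right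
  decomp_right := h.decomp_left
  left_nonempty := h.right_nonempty
  right_nonempty := h.left_nonempty
  quot_unique := fun b hb a ha b₀ hb₀ a₀ ha₀ hq =>
    (h.quot_unique a ha b hb a₀ ha₀ b₀ hb₀ (by rw [add_comm a b, add_comm a₀ b₀]; exact hq)).symm
  cosetCount_add := by rw [add_comm B A, h.cosetCount_add, add_comm]
  mem_of_unique := fun b hb a ha h1 =>
    (h.mem_of_unique a ha b hb (by rw [Grynkiewicz2009.addConvolution_comm, add_comm a b]; exact h1)).symm
  elementary := h.elementary.symm

/-- Kemperman decompositions are translation invariant. [cite: Grynkiewicz2009, §2 (KST)] -/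
theorem vadd (h : IsKempermanDecomp H A B A₁ A₀ B₁ B₀) (g g' : G) :
    IsKempermanDecomp H (g +ᵥ A) (g' +ᵥ B) (g +ᵥ A₁) (g +ᵥ A₀) (g' +ᵥ B₁) (g' +ᵥ B₀) where
  decomp_left := h.decomp_left.vadd g
  decomp_right := h.decomp_right.vadd g'
  left_nonempty := h.left_nonempty.vadd_finset
  right_nonempty := h.right_nonempty.vadd_finset
  quot_unique := by
    intro a ha b hb a₀ ha₀ b₀ hb₀ hq
    obtain ⟨a', ha', rfl⟩ := mem_vadd_finset.1 ha
    obtain ⟨b', hb', rfl⟩ := mem_vadd_finset.1 hb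
    obtain ⟨a₀', ha₀', rfl⟩ := mem_vadd_finset.1 ha₀
    obtain ⟨b₀', hb₀', rfl⟩ := mem_vadd_finset.1 hb₀
    have e : (g +ᵥ a') + (g' +ᵥ b') - ((g +ᵥ a₀') + (g' +ᵥ b₀')) = a' + b' - (a₀' + b₀') := by
      simp only [vadd_eq_add]; abel
    rw [e] at hq
    have := h.quot_unique a' ha' b' hb' a₀' ha₀' b₀' hb₀' hq
    simp only [vadd_eq_add, add_sub_add_left_eq_sub]
    exact this
  cosetCount_add := by
    rw [vadd_finset_add_vadd_finset, cosetCount_vadd, cosetCount_vadd, cosetCount_vadd, h.cosetCount_add]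
  mem_of_unique := by
    intro a ha b hb h1
    obtain ⟨a', ha', rfl⟩ := mem_vadd_finset.1 ha
    obtain ⟨b', hb', rfl⟩ := mem_vadd_finset.1 hb
    rw [addConvolution_vadd_vadd] at h1
    have e : (g +ᵥ a') + (g' +ᵥ b') - g - g' = a' + b' := by simp only [vadd_eq_add]; abel
    rw [e] at h1
    obtain ⟨h2, h3⟩ := h.mem_of_unique a' ha' b' hb' h1
    exact ⟨mem_vadd_finset.2 ⟨a', h2, rfl⟩, mem_vadd_finset.2 ⟨b', h3, rfl⟩⟩
  elementary := h.elementary.vadd g g'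

/-- Kemperman decompositions are invariant under negation. [cite: Grynkiewicz2009, §2 (KST)] -/
theorem neg (h : IsKempermanDecomp H A B A₁ A₀ B₁ B₀) :
    IsKempermanDecomp H (-A) (-B) (-A₁) (-A₀) (-B₁) (-B₀) where
  decomp_left := h.decomp_left.neg
  decomp_right := h.decomp_right.neg
  left_nonempty := h.left_nonempty.neg
  right_nonempty := h.right_nonempty.neg
  quot_unique := by
    intro a ha b hb a₀ ha₀ b₀ hb₀ hq
    rw [mem_neg'] at ha hb ha₀ hb₀
    have e : -a + -b - (-a₀ + -b₀) = -(a + b - (a₀ + b₀)) := by abel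
    have := h.quot_unique (-a) ha (-b) hb (-a₀) ha₀ (-b₀) hb₀ (by rw [e]; exact H.neg_mem hq)
    have e1 : -a - -a₀ = -(a - a₀) := by abel
    have e2 : -b - -b₀ = -(b - b₀) := by abel
    rw [e1, e2, H.neg_mem_iff, H.neg_mem_iff] at this
    exact this
  cosetCount_add := by
    rw [← neg_add, cosetCount_neg, cosetCount_neg, cosetCount_neg, h.cosetCount_add]
  mem_of_unique := by
    intro a ha b hb h1
    rw [mem_neg'] at ha hb
    rw [addConvolution_neg_neg, neg_add] at h1
    obtain ⟨h2, h3⟩ := h.mem_of_unique (-a) ha (-b) hb h1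
    exact ⟨mem_neg'.2 h2, mem_neg'.2 h3⟩
  elementary := h.elementary.neg

end IsKempermanDecomp

end Invariance

/-! ### Kemperman's 1960 wording of types (III) and (IV); elementary pairs are Kemperman pairs

Kemperman's own definition of the elementary pairs (Acta Math. 103 (1960), §5, p. 78): «(III) For some
finite group `H`, each of `A₁`, `B₁` is contained in an `H`-coset while `|A₁| + |B₁| = |H| + 1;
(hence, `A₁ + B₁` is an `H`-coset).  Moreover, precisely one element `c` satisfies `ν_c(A₁, B₁) = 1`.
(IV) `A₁` is aperiodic.  Further, for some finite subgroup `H` of `G`, `A₁` is contained in an `H`-coset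
while `B₁` is of the form `B₁ = g₀ − Ā₁ ∩ (a + H)` (`a ∈ A₁`) …  Moreover, no element `c` satisfies
`ν_c(A₁, B₁) = 1`.»  These agree with the renderings above (Grynkiewicz's wording): for (III) the
unique `c` is automatically `a + b` with `a ∈ A`, `b ∈ B`; for (IV) the aperiodicity of the second set
is automatic. [cite: Kemperman1960, §5 (definition of elementary pairs); Thm 5.1] -/

section KempermanForms

/-- **Type (III) in Kemperman's wording**: `A`, `B` inside `H`-cosets, `|A| + |B| = |H| + 1`, and
precisely one `c` with `r_{A,B}(c) = 1`. [cite: Kemperman1960, §5 (type (III))]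
[cite: Grynkiewicz2009, §2 (type (III))] -/
theorem isElementaryIII_iff_existsUnique {A B : Finset G} :
    IsElementaryIII A B ↔ A.Nonempty ∧ B.Nonempty ∧ ∃ H : AddSubgroup G,
      (∀ x ∈ A, ∀ x' ∈ A, x - x' ∈ H) ∧ (∀ y ∈ B, ∀ y' ∈ B, y - y' ∈ H) ∧
      #A + #B = Nat.card H + 1 ∧ ∃! c, A.addConvolution B c = 1 := by
  constructor
  · rintro ⟨H, a, b, ha, hb, hA, hB, hcard, huniq⟩
    refine ⟨⟨a, ha⟩, ⟨b, hb⟩, H, fun x hx x' hx' => ?_, fun y hy y' hy' => ?_, hcard,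
      ⟨a + b, (huniq _).2 rfl, fun c hc => (huniq c).1 hc⟩⟩
    · have e : x - x' = (x - a) - (x' - a) := by abel
      rw [e]; exact H.sub_mem (hA x hx) (hA x' hx')
    · have e : y - y' = (y - b) - (y' - b) := by abel
      rw [e]; exact H.sub_mem (hB y hy) (hB y' hy')
  · rintro ⟨hAne, hBne, H, hA, hB, hcard, c, hc, huniq⟩
    have hcAB : c ∈ A + B := addConvolution_pos.1 (by rw [hc]; exact Nat.one_pos)
    obtain ⟨a, ha, b, hb, rfl⟩ := mem_add.1 hcAB
    refine ⟨H, a, b, ha, hb, fun x hx => hA x hx a ha, fun y hy => hB y hy b hb, hcard, fun x => ?_⟩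
    exact ⟨fun hx => huniq x hx, fun hx => by rw [hx]; exact hc⟩

/-- In Kemperman's type (IV) only the first set is required to be aperiodic: if `A ⊆ a + H` is not
periodic, `B ≠ ∅` and `B = g − ((a + H) ∖ A)`, then `B` is not periodic either (a period `k` of `B`
lies in `H`, and then `−k` is a period of `A`). [cite: Kemperman1960, §5 (type (IV))] -/
theorem not_isPeriodic_of_eq_sub_sdiff {A B : Finset G} {H : AddSubgroup G} {a g : G}
    (hA : ∀ x ∈ A, x - a ∈ H) (hAap : ¬ IsPeriodic A) (hBne : B.Nonempty)
    (hBg : ∀ y, y ∈ B ↔ (g - y) - a ∈ H ∧ g - y ∉ A) : ¬ IsPeriodic B := by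
  rintro ⟨K, hK, hper⟩
  obtain ⟨k, hkK, hk0⟩ : ∃ k ∈ K, k ≠ (0 : G) := by
    by_contra hne
    push Not at hne
    exact hK ((AddSubgroup.eq_bot_iff_forall _).2 hne)
  obtain ⟨y₀, hy₀⟩ := hBne
  -- `k ∈ H`
  have hkH : k ∈ H := by
    have h1 := ((hBg y₀).1 hy₀).1
    have h2 := ((hBg (k + y₀)).1 (hper.add_mem hkK hy₀)).1
    have e : k = (g - y₀ - a) - (g - (k + y₀) - a) := by abel
    rw [e]; exact H.sub_mem h1 h2
  -- `−k + A ⊆ A`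
  have hsub : -k +ᵥ A ⊆ A := by
    intro w hw
    obtain ⟨x, hx, rfl⟩ := mem_vadd_finset.1 hw
    by_contra hxk
    have hy : g - x + k ∈ B := by
      refine (hBg _).2 ⟨?_, ?_⟩
      · have e : g - (g - x + k) - a = (x - a) - k := by abel
        rw [e]; exact H.sub_mem (hA x hx) hkH
      · have e : g - (g - x + k) = -k +ᵥ x := by rw [vadd_eq_add]; abel
        rw [e]; exact hxk
    have hy' : -k + (g - x + k) ∈ B := hper.add_mem (K.neg_mem hkK) hy
    have e : -k + (g - x + k) = g - x := by abel
    rw [e] at hy'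
    exact ((hBg _).1 hy').2 (by rw [sub_sub_cancel]; exact hx)
  have heq : -k +ᵥ A = A := eq_of_subset_of_card_le hsub (by rw [card_vadd_finset])
  refine hAap ⟨AddSubgroup.zmultiples (-k), ?_, isPeriodicWith_zmultiples_of_vadd_eq heq⟩
  rw [Ne, AddSubgroup.zmultiples_eq_bot, neg_eq_zero]
  exact hk0

/-- **Type (IV) in Kemperman's wording**: `A` aperiodic inside an `H`-coset `a + H`, `B ≠ ∅` of the
form `B = g − ((a + H) ∖ A)`, and no unique expression element. [cite: Kemperman1960, §5 (type (IV))]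
[cite: Grynkiewicz2009, §2 (type (IV))] -/
theorem isElementaryIV_iff_left {A B : Finset G} :
    IsElementaryIV A B ↔ B.Nonempty ∧ ∃ (H : AddSubgroup G) (a g : G), a ∈ A ∧ (∀ x ∈ A, x - a ∈ H) ∧
      ¬ IsPeriodic A ∧ (∀ x, A.addConvolution B x ≠ 1) ∧
      ∀ y, y ∈ B ↔ (g - y) - a ∈ H ∧ g - y ∉ A := by
  constructor
  · intro h
    obtain ⟨H, b, a, g, hb, ha, -, hA, hnone, -, hAap, hBg⟩ := h.symm
    exact ⟨⟨b, hb⟩, H, a, g, ha, hA, hAap, fun x => by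
      rw [Grynkiewicz2009.addConvolution_comm]; exact hnone x, hBg⟩
  · rintro ⟨⟨b, hb⟩, H, a, g, ha, hA, hAap, hnone, hBg⟩
    have hBap : ¬ IsPeriodic B := not_isPeriodic_of_eq_sub_sdiff hA hAap ⟨b, hb⟩ hBg
    have hB : ∀ y ∈ B, y - b ∈ H := by
      intro y hy
      have e : y - b = (g - b - a) - (g - y - a) := by abel
      rw [e]; exact H.sub_mem ((hBg b).1 hb).1 ((hBg y).1 hy).1
    have hIV : IsElementaryIV B A :=
      ⟨H, b, a, g, hb, ha, hB, hA, fun x => by rw [Grynkiewicz2009.addConvolution_comm]; exact hnone x,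
        hBap, hAap, hBg⟩
    exact hIV.symm

/-- **Every elementary pair is a Kemperman pair** with quasi-period `H = G` and empty periodic parts
(«Note every set has a quasi-periodic decomposition with `H = G` and `A₁ = ∅`»; the base of the
recursion «repeated application of KST modulo the quasi-period»), in a nontrivial group.
[cite: Grynkiewicz2009, §2 (KST and the remarks after it)] -/
theorem IsElementaryPair.isKempermanDecomp_top {A B : Finset G} (h : IsElementaryPair A B)
    (hG : (⊤ : AddSubgroup G) ≠ ⊥) : IsKempermanDecomp ⊤ A B ∅ A ∅ B where
  decomp_left := IsQuasiPeriodicDecomp.top A hG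
  decomp_right := IsQuasiPeriodicDecomp.top B hG
  left_nonempty := h.nonempty.1
  right_nonempty := h.nonempty.2
  quot_unique := fun _ _ _ _ _ _ _ _ _ => ⟨AddSubgroup.mem_top _, AddSubgroup.mem_top _⟩
  cosetCount_add := by
    rw [cosetCount_eq_one_of_sub_mem (h.nonempty.1.add h.nonempty.2)
        fun _ _ _ _ => AddSubgroup.mem_top _,
      cosetCount_eq_one_of_sub_mem h.nonempty.1 fun _ _ _ _ => AddSubgroup.mem_top _,
      cosetCount_eq_one_of_sub_mem h.nonempty.2 fun _ _ _ _ => AddSubgroup.mem_top _]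
  mem_of_unique := fun _ ha _ hb _ => ⟨ha, hb⟩
  elementary := h

/-- Hence the «only if» direction of KST holds for elementary pairs (in a nontrivial group).
[cite: Grynkiewicz2009, §2 (Kemperman Structure Theorem)] -/
theorem IsElementaryPair.exists_isKempermanDecomp {A B : Finset G} (h : IsElementaryPair A B)
    (hG : (⊤ : AddSubgroup G) ≠ ⊥) :
    ∃ (H : AddSubgroup G) (A₁ A₀ B₁ B₀ : Finset G), IsKempermanDecomp H A B A₁ A₀ B₁ B₀ :=
  ⟨⊤, ∅, A, ∅, B, h.isKempermanDecomp_top hG⟩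

end KempermanForms

/-! ### Kemperman 1960, Lemmas 4.1–4.3: the sum a coset, a punctured coset, or a progression

«Let us first consider the simple case that `A + B` is either a coset or a coset with one element
deleted» (Kemperman 1960 §4, p. 72).  Throughout, Kemperman's standing inequality (1) is
`|A + B| ≤ |A| + |B| − 1`. [cite: Kemperman1960, §4 (Lemmas 4.1, 4.2, 4.3)] -/

section KempermanSection4

/-- **Kemperman 1960, Lemma 4.1.** «Let `H` denote a finite subgroup of `G`.  In order that (1) holds
and `A + B` coincide with an `H`-coset, it is necessary and sufficient that each of `A`, `B` is a
subset of some `H`-coset in such a way that `|A| + |B| > |H|`» (`H` carried as a finset; the coset of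
the sum is then `a + b + H` for any `a ∈ A`, `b ∈ B`). [cite: Kemperman1960, Lemma 4.1] -/
theorem kemperman_lemma41 {A B Hf : Finset G} {H : AddSubgroup G} (hHf : ∀ g, g ∈ Hf ↔ g ∈ H)
    {a b : G} (ha : a ∈ A) (hb : b ∈ B) :
    (#(A + B) + 1 ≤ #A + #B ∧ ∃ c : G, A + B = c +ᵥ Hf) ↔
      (A ⊆ a +ᵥ Hf ∧ B ⊆ b +ᵥ Hf ∧ #Hf < #A + #B) := by
  constructor
  · rintro ⟨hcrit, c, hc⟩
    have hsub : ∀ {X Y : Finset G} {x y : G}, x ∈ X → y ∈ Y → X + Y = c +ᵥ Hf → X ⊆ x +ᵥ Hf := by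
      intro X Y x y hx hy hXY z hz
      have h1 : z + y ∈ c +ᵥ Hf := hXY ▸ add_mem_add hz hy
      have h2 : x + y ∈ c +ᵥ Hf := hXY ▸ add_mem_add hx hy
      obtain ⟨h₁, hh₁, e₁⟩ := mem_vadd_finset.1 h1
      obtain ⟨h₂, hh₂, e₂⟩ := mem_vadd_finset.1 h2
      refine mem_vadd_finset.2 ⟨h₁ - h₂, (hHf _).2 (H.sub_mem ((hHf _).1 hh₁) ((hHf _).1 hh₂)), ?_⟩
      have e : z = x + ((c +ᵥ h₁) - (c +ᵥ h₂)) := by rw [e₁, e₂]; abel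
      rw [e]; simp only [vadd_eq_add]; abel
    refine ⟨hsub ha hb hc, hsub hb ha (by rw [add_comm B A]; exact hc), ?_⟩
    have : #(A + B) = #Hf := by rw [hc, card_vadd_finset]
    omega
  · rintro ⟨hA, hB, hcard⟩
    have heq := add_eq_vadd_carrier_of_card_lt hHf hA hB hcard
    refine ⟨?_, a + b, heq⟩
    rw [heq, card_vadd_finset]; omega

/-- **Kemperman 1960, Lemma 4.2 (necessity).** «Let `H` denote a finite subgroup of `G`.  In order
that (1) holds and that `A + B` is obtained from an `H`-coset by deleting one element `c₀`, it is
necessary … that `A` is an aperiodic subset of some `H`-coset, while `B` is of the form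
`B = c₀ − Ā ∩ (a + H)` (`a ∈ A`).  If so, (1) holds with the equality sign.» (`H` carried as a finset;
proof as printed: `B ⊆ B' = c₀ − Ā ∩ (a + H)` because `c₀ ∉ A + B`, and `|B| ≥ |H| − |A| = |B'|` by
(1); `A` is aperiodic because the punctured coset `A + B` is.)  Sufficiency is
`IsElementaryIV.add_eq_of_data` (with the roles of the two sets as in `isElementaryIV_iff_left`).
[cite: Kemperman1960, Lemma 4.2] -/
theorem kemperman_lemma42 {A B Hf : Finset G} {H : AddSubgroup G} (hHf : ∀ g, g ∈ Hf ↔ g ∈ H)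
    {a c₀ : G} (ha : a ∈ A) (hB : B.Nonempty)
    (hsum : A + B = (c₀ +ᵥ Hf).erase c₀) (hcrit : #(A + B) + 1 ≤ #A + #B) :
    (∀ x ∈ A, x - a ∈ H) ∧ ¬ IsPeriodic A ∧ (∀ y, y ∈ B ↔ (c₀ - y) - a ∈ H ∧ c₀ - y ∉ A) ∧
      #(A + B) + 1 = #A + #B := by
  obtain ⟨b, hb⟩ := hB
  have h0 : (0 : G) ∈ Hf := (hHf 0).2 H.zero_mem
  have hc₀mem : c₀ ∈ c₀ +ᵥ Hf := mem_vadd_finset.2 ⟨0, h0, by rw [vadd_eq_add, add_zero]⟩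
  -- every sum lies in `c₀ + H`
  have hin : ∀ x ∈ A, ∀ y ∈ B, x + y - c₀ ∈ H := by
    intro x hx y hy
    have := hsum ▸ add_mem_add hx hy
    obtain ⟨h, hh, e⟩ := mem_vadd_finset.1 (mem_of_mem_erase this)
    rw [← e, vadd_eq_add, add_sub_cancel_left]; exact (hHf h).1 hh
  have hA : ∀ x ∈ A, x - a ∈ H := by
    intro x hx
    have e : x - a = (x + b - c₀) - (a + b - c₀) := by abel
    rw [e]; exact H.sub_mem (hin x hx b hb) (hin a ha b hb)
  have hc₀AB : c₀ ∉ A + B := by rw [hsum]; exact notMem_erase c₀ _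
  -- `B ⊆ B' = c₀ − ((a + H) ∖ A)`
  have hBsub : B ⊆ ((a +ᵥ Hf) \ A).image fun z => c₀ - z := by
    intro y hy
    refine mem_image.2 ⟨c₀ - y, mem_sdiff.2 ⟨?_, fun hmem => hc₀AB ?_⟩, sub_sub_cancel c₀ y⟩
    · refine mem_vadd_finset.2 ⟨c₀ - y - a, (hHf _).2 ?_, by rw [vadd_eq_add]; abel⟩
      have e : c₀ - y - a = -(a + y - c₀) := by abel
      rw [e]; exact H.neg_mem (hin a ha y hy)
    · have e : c₀ = (c₀ - y) + y := by abel
      rw [e]; exact add_mem_add hmem hy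
  have hAsub : A ⊆ a +ᵥ Hf := subset_vadd_carrier_of_sub_mem hHf hA
  have hcardB' : #(((a +ᵥ Hf) \ A).image fun z => c₀ - z) + #A = #Hf := by
    rw [card_image_of_injective _ sub_right_injective]
    have := card_sdiff_add_card_eq_card hAsub
    rw [card_vadd_finset] at this
    exact this
  have hcardAB : #(A + B) + 1 = #Hf := by
    rw [hsum, card_erase_of_mem hc₀mem, card_vadd_finset]
    have := card_pos.2 ⟨c₀, hc₀mem⟩
    rw [card_vadd_finset] at this
    omega
  have hle : #(((a +ᵥ Hf) \ A).image fun z => c₀ - z) ≤ #B := by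
    have h1 := hcardB'
    have h2 := hcardAB
    have h3 := hcrit
    omega
  have hBeq : B = ((a +ᵥ Hf) \ A).image fun z => c₀ - z := eq_of_subset_of_card_le hBsub hle
  have hcB := congrArg Finset.card hBeq
  refine ⟨hA, ?_, fun y => ?_, by omega⟩
  · -- `A` is aperiodic since the punctured coset `A + B` is
    rintro ⟨K, hK, hper⟩
    have hABne : (A + B).Nonempty := ⟨a + b, add_mem_add ha hb⟩
    have hH : H ≠ ⊥ := by
      intro hbot
      have hsub1 : Hf ⊆ {0} := fun x hx => by
        have := (hHf x).1 hx
        rw [hbot, AddSubgroup.mem_bot] at this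
        exact mem_singleton.2 this
      have h1 := card_le_card hsub1
      rw [card_singleton] at h1
      have h2 := hABne.card_pos
      omega
    have hins : insert c₀ (A + B) = c₀ +ᵥ Hf := by rw [hsum, insert_erase hc₀mem]
    exact not_isPeriodic_of_isPeriodicWith_insert hH hc₀AB (hins ▸ isPeriodicWith_vadd_carrier hHf _)
      hABne ⟨K, hK, hper.add_right B⟩
  · rw [hBeq, mem_image]
    constructor
    · rintro ⟨z, hz, rfl⟩
      rw [mem_sdiff] at hz
      obtain ⟨h, hh, rfl⟩ := mem_vadd_finset.1 hz.1
      refine ⟨?_, ?_⟩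
      · rw [sub_sub_cancel, vadd_eq_add, add_sub_cancel_left]; exact (hHf h).1 hh
      · rw [sub_sub_cancel]; exact hz.2
    · rintro ⟨h1, h2⟩
      exact ⟨c₀ - y, mem_sdiff.2 ⟨mem_vadd_finset.2 ⟨c₀ - y - a, (hHf _).2 h1, by
        rw [vadd_eq_add]; abel⟩, h2⟩, sub_sub_cancel c₀ y⟩

/-- Kemperman's Lemma 4.2 with the type (IV) vocabulary: a pair with small sumset whose sum is a
punctured coset and has no unique expression element is of type (IV). [cite: Kemperman1960, Lemma 4.2]
[cite: Grynkiewicz2009, §2 (type (IV))] -/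
theorem isElementaryIV_of_add_eq_erase {A B Hf : Finset G} {H : AddSubgroup G}
    (hHf : ∀ g, g ∈ Hf ↔ g ∈ H) {c₀ : G} (hA : A.Nonempty) (hB : B.Nonempty)
    (hsum : A + B = (c₀ +ᵥ Hf).erase c₀) (hcrit : #(A + B) + 1 ≤ #A + #B)
    (hnone : ∀ x, A.addConvolution B x ≠ 1) : IsElementaryIV A B := by
  obtain ⟨a, ha⟩ := hA
  obtain ⟨hAH, hAap, hBg, -⟩ := kemperman_lemma42 hHf ha hB hsum hcrit
  exact isElementaryIV_iff_left.2 ⟨hB, H, a, c₀, ha, hAH, hAap, hnone, hBg⟩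

/-- In a finite cyclic group generated by `d`, the complement of a progression with difference `d` is
a progression with difference `d`. [cite: Kemperman1960, §4 (proof of Lemma 4.3: «D̄ will denote the
complement of D in H … a set D is said to be in arithmetic progression iff …»)] -/
theorem IsAP.compl_of_zmultiples_eq_top [Fintype G] {S : Finset G} {d : G}
    (hd : AddSubgroup.zmultiples d = ⊤) (hS : IsAP S d) : IsAP Sᶜ d := by
  obtain ⟨a, hSa⟩ := hS
  have hn : addOrderOf d = Fintype.card G := Isoperimetric.addOrderOf_eq_card_of_zmultiples_eq_top hd
  have hSle : #S ≤ addOrderOf d := by rw [hn]; exact card_le_univ S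
  have huniv : apFinset a d (addOrderOf d) = univ := by
    rw [← add_zero a, ← vadd_apFinset, Isoperimetric.apFinset_zero_addOrderOf_eq_univ hd, vadd_finset_univ]
  obtain ⟨k, hk⟩ : ∃ k, #S + k = addOrderOf d := ⟨addOrderOf d - #S, by omega⟩
  have hsplit : univ = S ∪ apFinset (a + #S • d) d k := by
    rw [← huniv, ← hk, apFinset_add_eq_union, ← hSa]
  have hc2 : #(apFinset (a + #S • d) d k) ≤ k := card_apFinset_le _ _ _
  have hdisj : Disjoint S (apFinset (a + #S • d) d k) := by
    rw [disjoint_iff_inter_eq_empty, ← card_eq_zero]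
    have h1 := card_union_add_card_inter S (apFinset (a + #S • d) d k)
    rw [← hsplit, card_univ, ← hn] at h1
    omega
  have hcompl : Sᶜ = apFinset (a + #S • d) d k := by
    rw [compl_eq_univ_sdiff, hsplit, union_sdiff_left, sdiff_eq_self_of_disjoint hdisj.symm]
  refine ⟨a + #S • d, ?_⟩
  have hck : #Sᶜ = k := by
    have h1 := card_union_of_disjoint hdisj
    rw [← hsplit, card_univ, ← hn] at h1
    rw [hcompl]; omega
  rw [hck, hcompl]

/-- **Kemperman 1960, Lemma 4.3** (the cyclic case `G = ⟨d⟩`): «Suppose that (1) holds and that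
`A + B` is in arithmetic progression of difference `d ≠ 0`.  Suppose further that `|A + B| ≤ n − 2`,
where `n` denotes the order of the element `d`.  Then also `A` and `B` are in arithmetic progression of
difference `d`.  Moreover, in (1) the equality sign holds.»  Proof here (not Kemperman's): the
complement `S = G ∖ (−(A + B))` is a progression of difference `d` with `|S| ≥ 2`, and
`A + S ⊆ G ∖ (−B)` gives `|A + S| ≤ |A| + |S| − 1 < |G|`, so `A` is a progression by the Vosper-type
transfer `Isoperimetric.isAP_of_isAP_of_card_add_le` (Hamidoune–Serra–Zémor); symmetrically for `B`;
equality in (1) is Kneser's bound for the aperiodic progression `A + B`, here read off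
`|A + B| = |A| + |B| − 1` for two progressions of a common difference whose sum stays below the order.
[cite: Kemperman1960, Lemma 4.3] -/
theorem kemperman_lemma43 [Fintype G] {A B : Finset G} {d : G} (hd : AddSubgroup.zmultiples d = ⊤)
    (hA : A.Nonempty) (hB : B.Nonempty) (hAB : IsAP (A + B) d) (hcrit : #(A + B) + 1 ≤ #A + #B)
    (hsmall : #(A + B) + 2 ≤ Fintype.card G) : IsAP A d ∧ IsAP B d := by
  -- the transfer set `S = G ∖ (−(X + Y))` for a pair `(X, Y)`
  have key : ∀ {X Y : Finset G}, X.Nonempty → Y.Nonempty → IsAP (X + Y) d →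
      #(X + Y) + 1 ≤ #X + #Y → #(X + Y) + 2 ≤ Fintype.card G → IsAP X d := by
    intro X Y hX hY hXY hc hs
    have hS : IsAP (-(X + Y))ᶜ d := (hXY.neg).compl_of_zmultiples_eq_top hd
    have hScard : #(-(X + Y))ᶜ + #(X + Y) = Fintype.card G := by
      rw [card_compl, card_neg]; have := card_le_univ (X + Y); omega
    have hsub : X + (-(X + Y))ᶜ ⊆ (-Y)ᶜ := by
      intro z hz
      obtain ⟨x, hx, s, hs', rfl⟩ := mem_add.1 hz
      rw [mem_compl, mem_neg']
      intro hy
      rw [mem_compl] at hs'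
      apply hs'
      rw [mem_neg']
      have e : -s = x + -(x + s) := by abel
      rw [e]; exact add_mem_add hx hy
    have h1 : #(X + (-(X + Y))ᶜ) ≤ #(-Y)ᶜ := card_le_card hsub
    rw [card_compl, card_neg] at h1
    have hYle := card_le_univ Y
    exact Isoperimetric.isAP_of_isAP_of_card_add_le hd hS (by omega) hX (by omega) (by
      have := hY.card_pos; omega)
  refine ⟨key hA hB hAB hcrit hsmall, key hB hA ?_ ?_ ?_⟩
  · rw [add_comm B A]; exact hAB
  · rw [add_comm B A]; omega
  · rw [add_comm B A]; exact hsmall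

/-- Under the hypotheses of Kemperman's Lemma 4.3 the pair is of type (II) when `|A|, |B| ≥ 2` (the
order of `d` is `|G| ≥ |A + B| + 2 ≥ |A| + |B| + 1`), and «in (1) the equality sign holds».
[cite: Kemperman1960, Lemma 4.3] [cite: Grynkiewicz2009, §2 (type (II))] -/
theorem isElementaryII_of_isAP_add [Fintype G] {A B : Finset G} {d : G}
    (hd : AddSubgroup.zmultiples d = ⊤) (hA : 2 ≤ #A) (hB : 2 ≤ #B) (hAB : IsAP (A + B) d)
    (hcrit : #(A + B) + 1 ≤ #A + #B) (hsmall : #(A + B) + 2 ≤ Fintype.card G) :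
    IsElementaryII A B ∧ #(A + B) + 1 = #A + #B := by
  obtain ⟨hAd, hBd⟩ := kemperman_lemma43 hd (card_pos.1 (by omega)) (card_pos.1 (by omega)) hAB
    hcrit hsmall
  have hn : addOrderOf d = Fintype.card G := Isoperimetric.addOrderOf_eq_card_of_zmultiples_eq_top hd
  -- `|A + B| ≥ |A| + |B| − 1`: the sum of the two progressions has `|A| + |B| − 1` distinct terms
  obtain ⟨a, hAa⟩ := hAd
  obtain ⟨b, hBb⟩ := hBd
  have hsum : A + B = apFinset (a + b) d (#A + #B - 1) := by
    have : A + B = apFinset a d #A + apFinset b d #B := by rw [← hAa, ← hBb]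
    rw [this, Isoperimetric.apFinset_add_apFinset a b d (by omega) (by omega)]
  have hge : #A + #B ≤ #(A + B) + 1 := by
    by_contra hlt
    -- then `|A| + |B| − 1 > |A + B|`, so the first `|A + B| + 1 ≤ n` terms are distinct: contradiction
    have hle : #(A + B) + 1 ≤ addOrderOf d := by rw [hn]; omega
    have hsub : apFinset (a + b) d (#(A + B) + 1) ⊆ A + B := by
      intro x hx
      obtain ⟨i, hi, rfl⟩ := mem_apFinset.1 hx
      rw [hsum]
      exact mem_apFinset.2 ⟨i, by omega, rfl⟩
    have := card_le_card hsub
    rw [Isoperimetric.card_apFinset_of_le_addOrderOf _ _ hle] at this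
    omega
  refine ⟨⟨hA, hB, d, ⟨a, hAa⟩, ⟨b, hBb⟩, Or.inr ?_⟩, by omega⟩
  rw [hn]; omega

end KempermanSection4

/-! ### Two printed remarks on iterating KST -/

/-- «Type (IV) … implies that `A + B` is a punctured `H`-periodic set with `|H| ≥ 6`» (print p. 71):
`|A| + |B| = |H| ≥ 6` and `|A + B| = |H| − 1 ≥ 5`. [cite: Grynkiewicz2009, §2 (remarks after KST)] -/
theorem IsElementaryIV.six_le_card_add_card {A B : Finset G} (h : IsElementaryIV A B) :
    6 ≤ #A + #B ∧ 5 ≤ #(A + B) := by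
  have h3 := h.three_le_card
  have hc := h.card_add
  omega

/-- «Conditions (i) and (ii) imply that the pair `(φ_H(A), φ_H(B))` satisfies the hypothesis of KST.
Hence repeated application of KST modulo the quasi-period yields a complete recursive description of the
pair `(A, B)`» (print p. 70): the image pair in `G ⧸ H` is critical and has a unique expression element.
[cite: Grynkiewicz2009, §2 (remarks after KST)] -/
theorem IsKempermanDecomp.image_quotient {H : AddSubgroup G} [DecidableEq (G ⧸ H)]
    {A B A₁ A₀ B₁ B₀ : Finset G} (h : IsKempermanDecomp H A B A₁ A₀ B₁ B₀) :
    #(A.image (QuotientAddGroup.mk : G → G ⧸ H) + B.image (QuotientAddGroup.mk : G → G ⧸ H)) + 1 =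
        #(A.image (QuotientAddGroup.mk : G → G ⧸ H)) + #(B.image (QuotientAddGroup.mk : G → G ⧸ H)) ∧
      ∃ q, (A.image (QuotientAddGroup.mk : G → G ⧸ H)).addConvolution
        (B.image (QuotientAddGroup.mk : G → G ⧸ H)) q = 1 := by
  obtain ⟨a₀, ha₀⟩ := h.left_nonempty
  obtain ⟨b₀, hb₀⟩ := h.right_nonempty
  refine ⟨?_, QuotientAddGroup.mk (a₀ + b₀),
    (quot_unique_iff_addConvolution_image h.decomp_left h.decomp_right ha₀ hb₀).1 h.quot_unique⟩
  have himg : A.image (QuotientAddGroup.mk : G → G ⧸ H) + B.image (QuotientAddGroup.mk : G → G ⧸ H) =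
      (A + B).image (QuotientAddGroup.mk : G → G ⧸ H) := by
    rw [← QuotientAddGroup.coe_mk', ← image_add]
  rw [himg, ← cosetCount_eq_card_image, ← cosetCount_eq_card_image, ← cosetCount_eq_card_image]
  exact h.cosetCount_add

/-! ### The decompositions of Kemperman's Theorem 5.1 («KST I»): conditions (i), (ii), (iv) -/

/-- **Kemperman decompositions in Kemperman's own form** (Acta Math. 1960, Thm 5.1 (i)–(iv) =
Grynkiewicz 2005 «KST I» (i)–(iii)): as `IsKempermanDecomp` but WITHOUT Grynkiewicz's 2009 condition
(iii) on unique expression elements («Condition (iii) was not stated in Kemperman's original paper,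
but can be derived from KST as shown in [10] [11]», Grynkiewicz 2009 p. 70).  Kemperman: «the
existence of a non-empty subset `A₁` of `A`, a non-empty subset `B₁` of `B` and a subgroup `F` of `G`
of order `|F| ≥ 2`, such that: (i) the pair `(A₁, B₁)` is elementary, each of `A₁`, `B₁` is contained
in an `F`-coset. (ii) The element `σA₁ + σB₁` has `σA₁ + σB₁` as its only representation of the form
`ā + b̄`, `ā ∈ σA`, `b̄ ∈ σB` … (iii) `A ∖ A₁ + F = A ∖ A₁`, `B ∖ B₁ + F = B ∖ B₁` … (iv)
`|σA + σB| = |σA| + |σB| − 1`» (his `A₁, B₁, F` = our `A₀, B₀, H`).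
[cite: Kemperman1960, Thm 5.1] [cite: Grynkiewicz2005, §2 (KST I)] -/
structure IsKempermanDecompI (H : AddSubgroup G) (A B A₁ A₀ B₁ B₀ : Finset G) : Prop where
  /-- `A = A₁ ∪ A₀` is a quasi-periodic decomposition with quasi-period `H` -/
  decomp_left : IsQuasiPeriodicDecomp H A A₁ A₀
  /-- `B = B₁ ∪ B₀` is a quasi-periodic decomposition with quasi-period `H` -/
  decomp_right : IsQuasiPeriodicDecomp H B B₁ B₀
  /-- `A₀ ≠ ∅` -/
  left_nonempty : A₀.Nonempty
  /-- `B₀ ≠ ∅` -/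
  right_nonempty : B₀.Nonempty
  /-- (ii) of Kemperman: `φ_H(A₀) + φ_H(B₀)` is a unique expression element in `φ_H(A) + φ_H(B)` -/
  quot_unique : ∀ a ∈ A, ∀ b ∈ B, ∀ a₀ ∈ A₀, ∀ b₀ ∈ B₀, (a + b) - (a₀ + b₀) ∈ H →
    a - a₀ ∈ H ∧ b - b₀ ∈ H
  /-- (iv) of Kemperman: `|φ_H(A + B)| = |φ_H(A)| + |φ_H(B)| − 1` -/
  cosetCount_add : cosetCount H (A + B) + 1 = cosetCount H A + cosetCount H B
  /-- (i) of Kemperman: `(A₀, B₀)` is an elementary pair -/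
  elementary : IsElementaryPair A₀ B₀

/-- A Kemperman decomposition in Grynkiewicz's form is one in Kemperman's form.
[cite: Grynkiewicz2009, §2 (KST)] [cite: Kemperman1960, Thm 5.1] -/
theorem IsKempermanDecomp.toDecompI {H : AddSubgroup G} {A B A₁ A₀ B₁ B₀ : Finset G}
    (h : IsKempermanDecomp H A B A₁ A₀ B₁ B₀) : IsKempermanDecompI H A B A₁ A₀ B₁ B₀ where
  decomp_left := h.decomp_left
  decomp_right := h.decomp_right
  left_nonempty := h.left_nonempty
  right_nonempty := h.right_nonempty
  quot_unique := h.quot_unique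
  cosetCount_add := h.cosetCount_add
  elementary := h.elementary

/-- Kemperman-form decompositions are symmetric in the two summands. [cite: Kemperman1960, Thm 5.1] -/
theorem IsKempermanDecompI.symm {H : AddSubgroup G} {A B A₁ A₀ B₁ B₀ : Finset G}
    (h : IsKempermanDecompI H A B A₁ A₀ B₁ B₀) : IsKempermanDecompI H B A B₁ B₀ A₁ A₀ where
  decomp_left := h.decomp_right
  decomp_right := h.decomp_left
  left_nonempty := h.right_nonempty
  right_nonempty := h.left_nonempty
  quot_unique := fun b hb a ha b₀ hb₀ a₀ ha₀ hq =>
    (h.quot_unique a ha b hb a₀ ha₀ b₀ hb₀ (by rw [add_comm a b, add_comm a₀ b₀]; exact hq)).symm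
  cosetCount_add := by rw [add_comm B A, h.cosetCount_add, add_comm]
  elementary := h.elementary.symm

/-- Every elementary pair is a Kemperman pair in Kemperman's form, with quasi-period `G`.
[cite: Kemperman1960, Thm 5.1] -/
theorem IsElementaryPair.isKempermanDecompI_top {A B : Finset G} (h : IsElementaryPair A B)
    (hG : (⊤ : AddSubgroup G) ≠ ⊥) : IsKempermanDecompI ⊤ A B ∅ A ∅ B :=
  (h.isKempermanDecomp_top hG).toDecompI

end Literature.Combinatorics.Additive
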